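import Literature.Barriers.ValiantsHypothesis.BIJL18CompletionRankGapProofs
import Literature.Barriers.ValiantsHypothesis.BIJL18TPhiTensorRankProofs
import Literature.Computability.Complexity.GapE3SATBoundedOccurrence
import HarnessLib

/-!
# Bläser–Ikenmeyer–Jindal–Lysikov 2018, §5 — discharge of Theorem 23 (NP-hardness of
approximating tensor rank within `1 + γ`)

Sibling proof file of `BIJL18MatrixCompletion.lean` (val-lit t23). Proves the named fact
`BIJL2018_thm23 K : ∃ γ : ℚ, 0 < γ ∧ (gapTensorRankProblem K γ).IsNPHard` for EVERY field `K`
(the source states `k = ℝ` or `ℂ`; the printed proof is field-independent), following the printed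
proof (ECCC p. 13–14): "we can assume that in our instances each variable appears in a constant
number of clauses. Let `c` be this constant. ... We get a tensor of shape `9s × 9s × (m + 1)` with
`m` rank-one slices, `m ≤ (12 + 3c)s`. ... If `φ` is satisfiable then `CR(T_φ) ≤ 5s` and
`R(T_φ) ≤ 5s + m`. If `φ` is at most `1 − ε` satisfiable then `R(T_φ) ≥ (5 + ε)s + m ≥
(1 + ε/(17 + 3c)) (5s + m)`" — with Lemma 22 (2) in its correct bounded-occurrence form
`BIJL2018_lemma22_gap` (`ε ↦ ε / c`; the printed `(5 + ε)s` is false as worded, see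
`not_BIJL2018_lemma22` in `BIJL18CompletionRankGapProofs.lean`), so that here
`γ = ε / (2 (B+1) (17 + 9B))` for the occurrence bound `B` (a variable may occur up to three
times in an E3 clause, whence `m ≤ (12 + 9B) s`).

* The gap source: `gapE3SATOcc_isNPHard_some` (`GapE3SATBoundedOccurrence.lean`): gap-E3SAT with
  every variable in at most `B` clauses is NP-hard for some `B` and some `ε₀ < 1/8` (the output of
  the tree's Dinur gap-amplification machine has a structural occurrence bound).
* Renaming (`BIJL18TRGap.dvars`, `rk`, `finVar`, `phi3`): the occurring variables of an E3-CNF `φ`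
  over `ℕ` are renamed injectively, by first occurrence, onto `Fin t`; `phi3` is `φ` as a
  `List (Clause₃ t)`; satisfiability and the value are preserved (`exists_numSat₃_phi3_eq`,
  `numSat₃_phi3_le`), every renamed variable occurs (`exists_lit_eq`), occurrence bounds transfer
  (`card_occ_phi3_le`).
* The integer tables (`a0T`, `xT`, `locT`, `auxT`, `sliceT`, `entryT`, `entriesT`, row `9j + r`,
  row-major `(h, I, J) ↦ h n² + I n + J`, `n = 9s`, `m = t + 9s + |aux|`) realise exactly the
  reindexed, renumbered tensor `T_φ` of `BIJL18TPhiCompletionRankProofs.lean`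
  (`slice₀OfList_entriesT`, `slicesOfList_entriesT`, along `eRow : Fin s × Fin 9 ≃ Fin (9s)` and
  `gEquiv : Fin m ≃ SliceIdx (phi3 φ)`, the auxiliary slices enumerated by the list `auxPairs` of
  ordered pairs of distinct occurrence positions of the same variable, `auxOf_bijective`).
* Thm. 18 for the reindexed `T_φ` (`TPhiRank.tensorRank_tphi_le_of_satisfiable`,
  `TPhiRank.le_tensorRank_tphi_of_gap`, file `BIJL18TPhiTensorRankProofs.lean`) gives the two sides
  (`tensorRank_instT_le`, `lt_tensorRank_instT`, size bound `mOf_le`).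
* `BIJL18TRGap.redT` (the instance map; guard "E3-CNF with a clause", the empty tensor — a
  yes-instance — otherwise; the empty formula is never a no-instance), the machine
  `BIJL18TRGap.redTFP` in the typed `CodeFP` algebra, `gapE3SATOcc_reducible_gapTensorRank`, and
  **`BIJL2018_thm23_holds`** (`PromiseProblem.IsHard.of_reducible_holds`).

Theorem-only file in spirit (its `def`s are proof plumbing: the renaming, the instance map and its
integer tables; no statement of `BIJL18MatrixCompletion.lean` is touched, no new fact). HONEST
FRAMING: typed literature; `VP ≠ VNP` is NOT proved and nothing here is progress on it.

## References

* [BlaserIkenmeyerJindalLysikov2018] M. Bläser, C. Ikenmeyer, G. Jindal, V. Lysikov, *Generalized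
  matrix completion and algebraic natural proofs*, STOC 2018 / ECCC TR18-064, §5: Thm. 18, Lemma 22,
  Thm. 23 (ECCC p. 12–14).
* [AroraBarak2009] S. Arora, B. Barak, *Computational Complexity: A Modern Approach*, CUP 2009,
  §1.3 (polynomial time on codes), Thm. 11.9 / §22.4 (gap-3SAT, E3).
* [Goldreich2006] O. Goldreich, *On promise problems: a survey*, 2006, Def. 1.4 (Karp reductions among
  promise problems).
-/

noncomputable section

namespace Literature.Barriers.ValiantsHypothesis

open Literature.Computability.AlgebraicComplexity Literature.Computability.Complexity
open _root_.Computability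

universe u

namespace BIJL18TRGap

open CNF MaxTwoSat BIJL18NPHard Lemma22

variable (φ : CNF ℕ)

/-! ### The distinct occurring variables, in order of first occurrence -/

/-- The positions of first occurrences in `vlist φ`. [cite: BlaserIkenmeyerJindalLysikov2018, §5 (proof of Thm. 23, ECCC p. 14)] -/
def firstPos : List ℕ :=
  (List.range (vlist φ).length).filter fun p => (vlist φ).idxOf ((vlist φ).getD p 0) = p

/-- The distinct occurring variables, in order of first occurrence. [cite: BlaserIkenmeyerJindalLysikov2018, §5 (proof of Thm. 23, ECCC p. 14)] -/
def dvars : List ℕ := (firstPos φ).map fun p => (vlist φ).getD p 0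

/-- The number `t` of distinct variables. [cite: BlaserIkenmeyerJindalLysikov2018, §5 (proof of Thm. 23, ECCC p. 14)] -/
def tN : ℕ := (dvars φ).length

/-- The rank of a variable: its position among the distinct occurring variables. [cite: BlaserIkenmeyerJindalLysikov2018, §5 (proof of Thm. 23, ECCC p. 14)] -/
def rk (v : ℕ) : ℕ := (dvars φ).idxOf v

/-- The distinct variables are exactly the occurring ones. [cite: BlaserIkenmeyerJindalLysikov2018, §5 (proof of Thm. 23, ECCC p. 14)] -/
theorem mem_dvars_iff {v : ℕ} : v ∈ dvars φ ↔ v ∈ vlist φ := by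
  unfold dvars firstPos
  simp only [List.mem_map, List.mem_filter, List.mem_range, decide_eq_true_eq]
  constructor
  · rintro ⟨p, ⟨hp, -⟩, rfl⟩
    rw [List.getD_eq_getElem _ _ hp]
    exact List.getElem_mem hp
  · intro hv
    have hlt := List.idxOf_lt_length_of_mem hv
    refine ⟨(vlist φ).idxOf v, ⟨hlt, ?_⟩, ?_⟩
    · rw [List.getD_eq_getElem _ _ hlt, List.getElem_idxOf hlt]
    · rw [List.getD_eq_getElem _ _ hlt, List.getElem_idxOf hlt]

/-- The distinct variables have no duplicates. [cite: BlaserIkenmeyerJindalLysikov2018, §5 (proof of Thm. 23, ECCC p. 14)] -/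
theorem nodup_dvars : (dvars φ).Nodup := by
  unfold dvars
  refine List.Nodup.map_on ?_ ((List.nodup_range).filter _)
  intro p hp p' hp' h
  unfold firstPos at hp hp'
  simp only [List.mem_filter, List.mem_range, decide_eq_true_eq] at hp hp'
  rw [← hp.2, ← hp'.2, h]

/-- An occurring variable has rank `< t`. [cite: BlaserIkenmeyerJindalLysikov2018, §5 (proof of Thm. 23, ECCC p. 14)] -/
theorem rk_lt {v : ℕ} (hv : v ∈ vlist φ) : rk φ v < tN φ :=
  List.idxOf_lt_length_of_mem ((mem_dvars_iff φ).2 hv)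

/-- The `k`-th distinct variable has rank `k`. [cite: BlaserIkenmeyerJindalLysikov2018, §5 (proof of Thm. 23, ECCC p. 14)] -/
theorem rk_getElem {k : ℕ} (hk : k < tN φ) : rk φ ((dvars φ)[k]'hk) = k :=
  (nodup_dvars φ).idxOf_getElem k hk

/-- The `k`-th distinct variable occurs. [cite: BlaserIkenmeyerJindalLysikov2018, §5 (proof of Thm. 23, ECCC p. 14)] -/
theorem getElem_dvars_mem {k : ℕ} (hk : k < tN φ) : (dvars φ)[k]'hk ∈ vlist φ :=
  (mem_dvars_iff φ).1 (List.getElem_mem hk)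

/-- `dvars[rk v] = v` for an occurring variable. [cite: BlaserIkenmeyerJindalLysikov2018, §5 (proof of Thm. 23, ECCC p. 14)] -/
theorem getElem_dvars_rk {v : ℕ} (hv : v ∈ vlist φ) : (dvars φ)[rk φ v]'(rk_lt φ hv) = v :=
  List.getElem_idxOf (rk_lt φ hv)

/-- The rank is injective on the occurring variables. [cite: BlaserIkenmeyerJindalLysikov2018, §5 (proof of Thm. 23, ECCC p. 14)] -/
theorem rk_injOn {v w : ℕ} (hv : v ∈ vlist φ) (h : rk φ v = rk φ w) : v = w :=
  (List.idxOf_inj ((mem_dvars_iff φ).2 hv)).1 h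

/-- A literal of a clause has its variable in `vlist`. [cite: BlaserIkenmeyerJindalLysikov2018, §5 (proof of Thm. 23, ECCC p. 14)] -/
theorem fst_mem_vlist {c : Clause ℕ} (hc : c ∈ φ) {l : Literal ℕ} (hl : l ∈ c) : l.1 ∈ vlist φ :=
  List.mem_map.2 ⟨l, List.mem_flatten.2 ⟨c, hc, hl⟩, rfl⟩

/-- At most `3s` distinct variables in a 3-CNF (width `≤ 3`). [cite: BlaserIkenmeyerJindalLysikov2018, §5 (proof of Thm. 23, ECCC p. 14)] -/
theorem tN_le (h3 : φ.IsWidthLE 3) : tN φ ≤ 3 * φ.length := by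
  have h1 : tN φ ≤ (vlist φ).length := by
    unfold tN dvars firstPos
    rw [List.length_map]
    exact (List.length_filter_le _ _).trans (by rw [List.length_range])
  have h2 : (vlist φ).length ≤ 3 * φ.length := by
    unfold vlist
    rw [List.length_map, List.length_flatten]
    have key : ∀ ψ : CNF ℕ, ψ.IsWidthLE 3 → (ψ.map List.length).sum ≤ 3 * ψ.length := by
      intro ψ hψ
      induction ψ with
      | nil => simp
      | cons d ψ ih =>
        rw [List.map_cons, List.sum_cons, List.length_cons]
        have := hψ d List.mem_cons_self
        have := ih fun d' hd' => hψ d' (List.mem_cons_of_mem _ hd')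
        omega
    exact key φ h3
  exact h1.trans h2

/-- The three slots. [folklore] -/
private theorem TPhiRank_fin3 (a : Fin 3) : a = 0 ∨ a = 1 ∨ a = 2 := by
  fin_cases a <;> decide

/-! ### The 3-CNF over `Fin t` -/

variable {φ}

/-- The renamed variable in `Fin t` (`t ≥ 1`; non-occurring junk goes to `0`). [cite: BlaserIkenmeyerJindalLysikov2018, §5 (proof of Thm. 23, ECCC p. 14)] -/
def finVar (ht : 0 < tN φ) (v : ℕ) : Fin (tN φ) :=
  if h : rk φ v < tN φ then ⟨rk φ v, h⟩ else ⟨0, ht⟩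

/-- The renamed literal over `Fin t`. [cite: BlaserIkenmeyerJindalLysikov2018, §5 (proof of Thm. 23, ECCC p. 14)] -/
def finLit (ht : 0 < tN φ) (l : Literal ℕ) : Literal (Fin (tN φ)) := (finVar ht l.1, l.2)

/-- **The 3-CNF `φ` as a list of literal triples over `Fin t`** (the input format of `T_φ`). [cite: BlaserIkenmeyerJindalLysikov2018, §5 (proof of Thm. 23, ECCC p. 14)] -/
def phi3 (ht : 0 < tN φ) : List (Clause₃ (tN φ)) :=
  φ.map fun c => (finLit ht (c.getD 0 (0, false)),
    finLit ht (c.getD 1 (0, false)), finLit ht (c.getD 2 (0, false)))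


/-! ### Reading `phi3` -/

/-- Proof plumbing for Thm. 23. [cite: BlaserIkenmeyerJindalLysikov2018, §5 (proof of Thm. 23, ECCC p. 14)] -/
@[simp] theorem length_phi3 (ht : 0 < tN φ) : (phi3 ht).length = φ.length := by simp [phi3]

/-- The literal of slot `a` of clause `j` of `phi3` is the renamed literal occurrence `litAt φ j a`. [cite: BlaserIkenmeyerJindalLysikov2018, §5 (proof of Thm. 23, ECCC p. 14)] -/
theorem phi3_lit (ht : 0 < tN φ) (j : Fin (phi3 ht).length) (a : Fin 3) :
    ((phi3 ht).get j).lit a = finLit ht (litAt φ j.1 a.1) := by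
  have hj : j.1 < φ.length := by simpa using j.2
  have hget : (phi3 ht).get j = (finLit ht ((φ.getD j.1 []).getD 0 (0, false)),
      finLit ht ((φ.getD j.1 []).getD 1 (0, false)), finLit ht ((φ.getD j.1 []).getD 2 (0, false))) := by
    rw [List.get_eq_getElem]
    simp only [phi3, List.getElem_map, List.getD_eq_getElem _ _ hj]
  unfold Clause₃.lit litAt
  rw [hget]
  rcases TPhiRank_fin3 a with rfl | rfl | rfl <;> simp

/-- For an occurring variable the clamped rank is the rank. [cite: BlaserIkenmeyerJindalLysikov2018, §5 (proof of Thm. 23, ECCC p. 14)] -/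
theorem finLit_fst_of_mem (ht : 0 < tN φ) {l : Literal ℕ} (hl : l.1 ∈ vlist φ) :
    ((finLit ht l).1 : ℕ) = rk φ l.1 := by
  simp only [finLit, finVar, dif_pos (rk_lt φ hl)]

/-- In an E3-CNF the literal occurrence `litAt φ j a` (`j < s`, `a < 3`) is a literal of clause `j`. [cite: BlaserIkenmeyerJindalLysikov2018, §5 (proof of Thm. 23, ECCC p. 14)] -/
theorem litAt_mem (hE : φ.IsExactWidth 3) {j : ℕ} (hj : j < φ.length) {a : ℕ} (ha : a < 3) :
    litAt φ j a ∈ φ[j] := by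
  unfold litAt
  rw [List.getD_eq_getElem _ _ hj, List.getD_eq_getElem _ _ (by rw [(hE _ (List.getElem_mem hj)).1]; exact ha)]
  exact List.getElem_mem _

/-- In an E3-CNF the variable of `litAt φ j a` occurs. [cite: BlaserIkenmeyerJindalLysikov2018, §5 (proof of Thm. 23, ECCC p. 14)] -/
theorem litAt_fst_mem_vlist (hE : φ.IsExactWidth 3) {j : ℕ} (hj : j < φ.length) {a : ℕ} (ha : a < 3) :
    (litAt φ j a).1 ∈ vlist φ :=
  fst_mem_vlist φ (List.getElem_mem hj) (litAt_mem hE hj ha)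

/-- An E3-CNF with a clause has a variable. [cite: BlaserIkenmeyerJindalLysikov2018, §5 (proof of Thm. 23, ECCC p. 14)] -/
theorem tN_pos (hE : φ.IsExactWidth 3) (hs : 0 < φ.length) : 0 < tN φ := by
  have h := litAt_fst_mem_vlist hE hs (a := 0) (by norm_num)
  exact lt_of_le_of_lt (Nat.zero_le _) (rk_lt φ h)

/-! ### The renamed assignment and the counts -/

/-- The assignment of the original variables induced by an assignment of the renamed ones. [cite: BlaserIkenmeyerJindalLysikov2018, §5 (proof of Thm. 23, ECCC p. 14)] -/
def pull (ht : 0 < tN φ) (τ : Fin (tN φ) → Bool) (v : ℕ) : Bool := τ (finVar ht v)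

/-- **The clause count is preserved by the renaming** (E3-CNF). [cite: BlaserIkenmeyerJindalLysikov2018, §5 (proof of Thm. 23, ECCC p. 14)] -/
theorem numSat₃_phi3 (hE : φ.IsExactWidth 3) (ht : 0 < tN φ) (τ : Fin (tN φ) → Bool) :
    numSat₃ (phi3 ht) τ = φ.numSatClauses (pull ht τ) := by
  rw [numSat₃, phi3, List.countP_map, numSatClauses]
  refine List.countP_congr fun c hc => ?_
  obtain ⟨l₁, l₂, l₃, rfl⟩ : ∃ l₁ l₂ l₃, c = [l₁, l₂, l₃] := by
    have h := (hE c hc).1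
    match c, h with
    | [l₁, l₂, l₃], _ => exact ⟨l₁, l₂, l₃, rfl⟩
  simp [Clause.eval, Literal.eval, finLit, pull, or_assoc]

/-- An assignment of the original variables, pushed to the renamed ones. [cite: BlaserIkenmeyerJindalLysikov2018, §5 (proof of Thm. 23, ECCC p. 14)] -/
def push (τσ : ℕ → Bool) (k : Fin (tN φ)) : Bool := τσ ((dvars φ)[k.1]'k.2)

/-- Pulling back the pushed assignment agrees with the original on occurring variables. [cite: BlaserIkenmeyerJindalLysikov2018, §5 (proof of Thm. 23, ECCC p. 14)] -/
theorem pull_push (ht : 0 < tN φ) (σ : ℕ → Bool) {v : ℕ} (hv : v ∈ vlist φ) : pull ht (push σ) v = σ v := by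
  have h1 := rk_lt φ hv
  have h2 := getElem_dvars_rk φ hv
  simp only [pull, push, finVar, dif_pos h1]
  exact congrArg σ h2

/-- Counting with an assignment that agrees on the occurring variables. [cite: BlaserIkenmeyerJindalLysikov2018, §5 (proof of Thm. 23, ECCC p. 14)] -/
theorem numSatClauses_congr_vlist {σ σ' : ℕ → Bool} (h : ∀ v ∈ vlist φ, σ v = σ' v) :
    φ.numSatClauses σ = φ.numSatClauses σ' := by
  unfold numSatClauses
  refine List.countP_congr fun c hc => ?_
  rw [clause_eval_congr' (σ := σ) (σ' := σ') fun l hl => h l.1 (fst_mem_vlist φ hc hl)]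

/-- **Yes side transfers**: a satisfiable E3-CNF gives an assignment satisfying every clause of `phi3`. [cite: BlaserIkenmeyerJindalLysikov2018, §5 (proof of Thm. 23, ECCC p. 14)] -/
theorem exists_numSat₃_phi3_eq (hE : φ.IsExactWidth 3) (ht : 0 < tN φ) (hsat : φ.Satisfiable) :
    ∃ τ : Fin (tN φ) → Bool, numSat₃ (phi3 ht) τ = (phi3 ht).length := by
  obtain ⟨σ, hσ⟩ := hsat
  refine ⟨push σ, ?_⟩
  rw [numSat₃_phi3 hE, numSatClauses_congr_vlist fun v hv => pull_push ht σ hv, length_phi3, numSatClauses]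
  rw [List.countP_eq_length]
  intro c hc
  unfold CNF.eval at hσ
  rw [List.all_eq_true] at hσ
  exact hσ c hc

/-- **No side transfers**: every assignment satisfies at most `val(φ) · s` clauses of `phi3`. [cite: BlaserIkenmeyerJindalLysikov2018, §5 (proof of Thm. 23, ECCC p. 14)] -/
theorem numSat₃_phi3_le (hE : φ.IsExactWidth 3) (ht : 0 < tN φ) (τ : Fin (tN φ) → Bool) :
    (numSat₃ (phi3 ht) τ : ℚ) ≤ φ.maxSatFraction * φ.length := by
  rw [numSat₃_phi3 hE]
  exact numSatClauses_le_maxSatFraction_mul φ _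

/-! ### Occurrences -/

/-- **Every renamed variable occurs in `phi3`** (E3-CNF). [cite: BlaserIkenmeyerJindalLysikov2018, §5 (proof of Thm. 23, ECCC p. 14)] -/
theorem exists_lit_eq (hE : φ.IsExactWidth 3) (ht : 0 < tN φ) (y : Fin (tN φ)) :
    ∃ q : Fin (phi3 ht).length × Fin 3, (((phi3 ht).get q.1).lit q.2).1 = y := by
  have hmem := getElem_dvars_mem φ y.2
  obtain ⟨l, hl, hlv⟩ := List.mem_map.1 hmem
  obtain ⟨c, hc, hlc⟩ := List.mem_flatten.1 hl
  obtain ⟨j, hj, rfl⟩ := List.getElem_of_mem hc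
  obtain ⟨a, ha, rfl⟩ := List.getElem_of_mem hlc
  have hlen : (φ[j]).length = 3 := (hE _ (List.getElem_mem hj)).1
  have ha3 : a < 3 := hlen ▸ ha
  refine ⟨(⟨j, by simpa using hj⟩, ⟨a, ha3⟩), ?_⟩
  rw [phi3_lit]
  apply Fin.ext
  have hlit : litAt φ j a = φ[j][a] := by
    unfold litAt; rw [List.getD_eq_getElem _ _ hj, List.getD_eq_getElem _ _ ha]
  simp only
  rw [finLit_fst_of_mem ht (by rw [hlit]; exact fst_mem_vlist φ (List.getElem_mem hj) (List.getElem_mem ha)), hlit, hlv]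
  exact rk_getElem φ y.2

/-- Sums of indicators are counts. [folklore] -/
private theorem sum_map_ite_eq_countP {α : Type*} (l : List α) (P : α → Prop) [DecidablePred P] :
    (l.map fun a => if P a then 1 else 0).sum = l.countP fun a => decide (P a) := by
  induction l with
  | nil => simp
  | cons a l ih =>
    rw [List.map_cons, List.sum_cons, List.countP_cons, ih, Nat.add_comm]
    by_cases h : P a
    · rw [if_pos h, if_pos (decide_eq_true h)]
    · rw [if_neg h, if_neg (by simpa using h)]

/-- Counting indices by a property of the entries is `countP`. [folklore] -/
private theorem card_filter_fin_eq_countP {α : Type*} (l : List α) (P : α → Prop) [DecidablePred P] :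
    (Finset.univ.filter fun j : Fin l.length => P (l[j.1]'j.2)).card = l.countP fun a => decide (P a) := by
  classical
  rw [Finset.card_filter, ← List.sum_ofFn, List.ofFn_getElem_eq_map l fun a => if P a then 1 else 0]
  exact sum_map_ite_eq_countP l P

/-- **The occurrence bound transfers**: if every variable of the E3-CNF `φ` occurs in at most `B`
clauses, every renamed variable occurs in at most `B` clauses of `phi3`. [cite: BlaserIkenmeyerJindalLysikov2018, §5 (proof of Thm. 23, ECCC p. 14)] -/
theorem card_occ_phi3_le (hE : φ.IsExactWidth 3) (ht : 0 < tN φ) {B : ℕ} (hB : ∀ x, φ.varOcc x ≤ B)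
    (y : Fin (tN φ)) :
    (Finset.univ.filter fun j : Fin (phi3 ht).length => ∃ a : Fin 3, (((phi3 ht).get j).lit a).1 = y).card ≤ B := by
  classical
  set v := (dvars φ)[y.1]'y.2 with hv
  have hvmem : v ∈ vlist φ := getElem_dvars_mem φ y.2
  -- rewrite through `countP` on `phi3`, then on `φ`
  have h1 : (Finset.univ.filter fun j : Fin (phi3 ht).length => ∃ a : Fin 3, (((phi3 ht).get j).lit a).1 = y).card =
      (phi3 ht).countP fun c => decide (∃ a : Fin 3, (c.lit a).1 = y) := by
    rw [← card_filter_fin_eq_countP]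
    rfl
  rw [h1, phi3, List.countP_map]
  refine le_trans (List.countP_mono_left fun c hc h => ?_) (hB v)
  -- a clause whose renamed literal triple contains `y` contains `v`
  simp only [Function.comp_apply, decide_eq_true_eq] at h ⊢
  obtain ⟨a, ha⟩ := h
  obtain ⟨j, hj, rfl⟩ := List.getElem_of_mem hc
  have hlen : (φ[j]).length = 3 := (hE _ (List.getElem_mem hj)).1
  -- the literal in slot `a`
  have key : ∀ (a : ℕ) (ha3 : a < 3), ((finLit ht ((φ[j]).getD a (0, false))).1 : ℕ) = y → v ∈ (φ[j]).map Prod.fst := by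
    intro a ha3 h
    have hm : (φ[j]).getD a (0, false) ∈ φ[j] := by
      rw [List.getD_eq_getElem _ _ (by rw [hlen]; exact ha3)]; exact List.getElem_mem _
    have hocc : ((φ[j]).getD a (0, false)).1 ∈ vlist φ := fst_mem_vlist φ (List.getElem_mem hj) hm
    rw [finLit_fst_of_mem ht hocc] at h
    have heq : ((φ[j]).getD a (0, false)).1 = v :=
      rk_injOn φ hocc (by rw [h, hv, rk_getElem φ y.2])
    exact List.mem_map.2 ⟨_, hm, heq⟩
  rcases TPhiRank_fin3 a with rfl | rfl | rfl
  · exact key 0 (by norm_num) (by simpa [Clause₃.lit] using congrArg Fin.val ha)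
  · exact key 1 (by norm_num) (by simpa [Clause₃.lit] using congrArg Fin.val ha)
  · exact key 2 (by norm_num) (by simpa [Clause₃.lit] using congrArg Fin.val ha)


/-! ### The integer tables of `T_φ` -/

variable (φ)

/-- The raw variable of occurrence position `(j, a)`. [cite: BlaserIkenmeyerJindalLysikov2018, §5 (proof of Thm. 23, ECCC p. 14)] -/
def varAt (j a : ℕ) : ℕ := (litAt φ j a).1

/-- The auxiliary pairs: ordered pairs of distinct occurrence positions `u = 3j + a` of the same
variable, in lexicographic order. [cite: BlaserIkenmeyerJindalLysikov2018, §5 (proof of Thm. 23, ECCC p. 14)] -/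
def auxPairs : List (ℕ × ℕ) :=
  ((List.range (3 * φ.length)) ×ˢ (List.range (3 * φ.length))).filter fun q =>
    q.1 ≠ q.2 ∧ varAt φ (q.1 / 3) (q.1 % 3) = varAt φ (q.2 / 3) (q.2 % 3)

/-- The number of auxiliary slices. [cite: BlaserIkenmeyerJindalLysikov2018, §5 (proof of Thm. 23, ECCC p. 14)] -/
def nA : ℕ := (auxPairs φ).length

/-- The side length `n = 9s`. [cite: BlaserIkenmeyerJindalLysikov2018, §5 (proof of Thm. 23, ECCC p. 14)] -/
def nOfT : ℕ := φ.length * 9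

/-- The number of slices `m = t + 9s + |aux|`. [cite: BlaserIkenmeyerJindalLysikov2018, §5 (proof of Thm. 23, ECCC p. 14)] -/
abbrev mOf : ℕ := tN φ + (φ.length * 9 + nA φ)

/-- The constant slice as an integer table (row `I = 9·clause + local index`). [cite: BlaserIkenmeyerJindalLysikov2018, §5 (proof of Thm. 23, ECCC p. 14)] -/
def a0T (I J : ℕ) : ℤ :=
  if I / 9 = J / 9 then
    (if J % 9 % 2 = 0 ∧ J % 9 ≤ 4 ∧ (I % 9 = J % 9 ∨ I % 9 = J % 9 + 1) then 1
     else if (I % 9 = 6 ∧ J % 9 = 7) ∨ (I % 9 = 7 ∧ J % 9 = 8) then 1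
     else if I % 9 = J % 9 ∧ 6 ≤ I % 9 ∧ (litAt φ (I / 9) (I % 9 - 6)).2 = true then 1 else 0)
  else 0

/-- The slice of the (renamed) formula variable `x`. [cite: BlaserIkenmeyerJindalLysikov2018, §5 (proof of Thm. 23, ECCC p. 14)] -/
def xT (x I J : ℕ) : ℤ :=
  if (I % 9 % 2 = 0 ∧ I % 9 ≤ 4 ∧ rk φ (varAt φ (I / 9) (I % 9 / 2)) = x) ∧
      (J % 9 % 2 = 1 ∧ J % 9 ≤ 5 ∧ rk φ (varAt φ (J / 9) (J % 9 / 2)) = x) then 1 else 0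

/-- The local slices `(j, a, wh)`. [cite: BlaserIkenmeyerJindalLysikov2018, §5 (proof of Thm. 23, ECCC p. 14)] -/
def locT (j a wh I J : ℕ) : ℤ :=
  if I / 9 = j ∧ J / 9 = j then
    (if wh = 0 then
      (if (I % 9 = 2 * a + 1 ∨ I % 9 = 6 + a) then
        (if J % 9 = 2 * a + 1 then 1 else if J % 9 = 6 + a then (if (litAt φ j a).2 then -1 else 1) else 0)
       else 0)
     else if wh = 1 then (if I % 9 = 2 * a + 1 ∧ J % 9 = 6 + a then -1 else 0)
     else (if I % 9 = 6 + a ∧ J % 9 = 2 * a + 1 then -1 else 0))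
  else 0

/-- The auxiliary slice of the pair `(u, u')` of occurrence positions. [cite: BlaserIkenmeyerJindalLysikov2018, §5 (proof of Thm. 23, ECCC p. 14)] -/
def auxT (u u' I J : ℕ) : ℤ :=
  if I = 9 * (u / 3) + 2 * (u % 3) ∧ J = 9 * (u' / 3) + (2 * (u' % 3) + 1) then 1 else 0

/-- Slice number `k` (`0 ≤ k < m`). [cite: BlaserIkenmeyerJindalLysikov2018, §5 (proof of Thm. 23, ECCC p. 14)] -/
def sliceT (k I J : ℕ) : ℤ :=
  if k < tN φ then xT φ k I J
  else if k < tN φ + φ.length * 9 then locT φ ((k - tN φ) / 9) ((k - tN φ) % 9 / 3) ((k - tN φ) % 9 % 3) I J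
  else auxT ((auxPairs φ).getD (k - tN φ - φ.length * 9) (0, 0)).1
    ((auxPairs φ).getD (k - tN φ - φ.length * 9) (0, 0)).2 I J

/-- Entry `(h, I, J)` of the tensor (`h = 0` the constant slice). [cite: BlaserIkenmeyerJindalLysikov2018, §5 (proof of Thm. 23, ECCC p. 14)] -/
def entryT (h I J : ℕ) : ℤ := if h = 0 then a0T φ I J else sliceT φ (h - 1) I J

/-- **The row-major entry list** of `T_φ`, `(m+1) n²` long. [cite: BlaserIkenmeyerJindalLysikov2018, §5 (proof of Thm. 23, ECCC p. 14)] -/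
def entriesT : List ℤ :=
  (List.range ((mOf φ + 1) * (nOfT φ * nOfT φ))).map fun N =>
    entryT φ (N / (nOfT φ * nOfT φ)) (N / nOfT φ % nOfT φ) (N % nOfT φ)

/-- **The instance** `(n, m, entries, 5s + m)`. [cite: BlaserIkenmeyerJindalLysikov2018, §5 (proof of Thm. 23, ECCC p. 14)] -/
def instT : ℕ × ℕ × List ℤ × ℕ := (nOfT φ, mOf φ, entriesT φ, 5 * φ.length + mOf φ)

/-- The fixed instance for the empty formula (a yes-instance: the empty tensor). [cite: BlaserIkenmeyerJindalLysikov2018, §5 (proof of Thm. 23, ECCC p. 14)] -/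
def yesInst : ℕ × ℕ × List ℤ × ℕ := (0, 0, [], 0)

/-- **The instance map**: E3-CNFs with a clause go to `instT`, everything else to `yesInst`. [cite: BlaserIkenmeyerJindalLysikov2018, §5 (proof of Thm. 23, ECCC p. 14)] -/
def redT (ψ : CNF ℕ) : ℕ × ℕ × List ℤ × ℕ :=
  if ψ.IsExactWidth 3 ∧ 0 < ψ.length then instT ψ else yesInst

/-- Length of the entry list. [cite: BlaserIkenmeyerJindalLysikov2018, §5 (proof of Thm. 23, ECCC p. 14)] -/
@[simp] theorem length_entriesT : (entriesT φ).length = (mOf φ + 1) * (nOfT φ * nOfT φ) := by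
  simp [entriesT]

/-- The instance is well formed. [cite: BlaserIkenmeyerJindalLysikov2018, §5 (proof of Thm. 23, ECCC p. 14)] -/
theorem wellFormedInst_instT : WellFormedInst (instT φ) := by
  simp [WellFormedInst, instT, sq]

/-- Reading the entry list in row-major position. [cite: BlaserIkenmeyerJindalLysikov2018, §5 (proof of Thm. 23, ECCC p. 14)] -/
theorem getD_entriesT {h I J : ℕ} (hh : h ≤ mOf φ) (hI : I < nOfT φ) (hJ : J < nOfT φ) :
    (entriesT φ).getD (h * (nOfT φ * nOfT φ) + I * nOfT φ + J) 0 = entryT φ h I J := by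
  set n := nOfT φ with hn
  have hn0 : 0 < n := by omega
  have hij : I * n + J < n * n := by nlinarith
  have hN : h * (n * n) + I * n + J < (mOf φ + 1) * (n * n) := by nlinarith
  rw [entriesT, List.getD_eq_getElem _ _ (by simpa using hN), List.getElem_map, List.getElem_range]
  have e1 : (h * (n * n) + I * n + J) / (n * n) = h := by
    rw [Nat.add_assoc, Nat.add_comm, Nat.add_mul_div_right _ _ (by positivity), Nat.div_eq_of_lt hij, zero_add]
  have e2 : (h * (n * n) + I * n + J) / n % n = I := by
    rw [show h * (n * n) + I * n + J = J + (h * n + I) * n by ring, Nat.add_mul_div_right _ _ hn0,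
      Nat.div_eq_of_lt hJ, zero_add, Nat.add_comm, Nat.add_mul_mod_self_right, Nat.mod_eq_of_lt hI]
  have e3 : (h * (n * n) + I * n + J) % n = J := by
    rw [show h * (n * n) + I * n + J = J + (h * n + I) * n by ring, Nat.add_mul_mod_self_right, Nat.mod_eq_of_lt hJ]
  rw [e1, e2, e3]

/-! ### The auxiliary pairs enumerate the auxiliary slice indices -/

/-- Proof plumbing for Thm. 23. [cite: BlaserIkenmeyerJindalLysikov2018, §5 (proof of Thm. 23, ECCC p. 14)] -/
theorem nodup_auxPairs : (auxPairs φ).Nodup :=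
  (List.nodup_range.product List.nodup_range).filter _

/-- Membership in the list of auxiliary pairs. [cite: BlaserIkenmeyerJindalLysikov2018, §5 (proof of Thm. 23, ECCC p. 14)] -/
theorem mem_auxPairs {q : ℕ × ℕ} : q ∈ auxPairs φ ↔
    q.1 < 3 * φ.length ∧ q.2 < 3 * φ.length ∧ q.1 ≠ q.2 ∧ varAt φ (q.1 / 3) (q.1 % 3) = varAt φ (q.2 / 3) (q.2 % 3) := by
  obtain ⟨u, u'⟩ := q
  simp only [auxPairs, List.mem_filter, List.mem_product, List.mem_range, decide_eq_true_eq, ne_eq]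
  tauto

/-- Crude bound: at most `9 s²` auxiliary pairs. [cite: BlaserIkenmeyerJindalLysikov2018, §5 (proof of Thm. 23, ECCC p. 14)] -/
theorem nA_le : nA φ ≤ 9 * φ.length ^ 2 := by
  unfold nA auxPairs
  refine (List.length_filter_le _ _).trans ?_
  rw [List.length_product, List.length_range]
  nlinarith

variable {φ}

/-- The variable of the literal of slot `(j, a)` of `phi3`, as a number, is the rank of the raw variable. [cite: BlaserIkenmeyerJindalLysikov2018, §5 (proof of Thm. 23, ECCC p. 14)] -/
theorem phi3_lit_fst_val (hE : φ.IsExactWidth 3) (ht : 0 < tN φ) (j : Fin (phi3 ht).length) (a : Fin 3) :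
    ((((phi3 ht).get j).lit a).1 : ℕ) = rk φ (varAt φ j.1 a.1) := by
  rw [phi3_lit, finLit_fst_of_mem ht (litAt_fst_mem_vlist hE (by simpa using j.2) a.2)]
  rfl

/-- The slot with position number `u < 3s`. [cite: BlaserIkenmeyerJindalLysikov2018, §5 (proof of Thm. 23, ECCC p. 14)] -/
def slotOf (ht : 0 < tN φ) (u : ℕ) (hu : u < 3 * φ.length) : Fin (phi3 ht).length × Fin 3 :=
  (⟨u / 3, by rw [length_phi3]; omega⟩, ⟨u % 3, Nat.mod_lt _ (by norm_num)⟩)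

/-- The position number of a slot. [cite: BlaserIkenmeyerJindalLysikov2018, §5 (proof of Thm. 23, ECCC p. 14)] -/
def posOf (ht : 0 < tN φ) (q : Fin (phi3 ht).length × Fin 3) : ℕ := 3 * q.1.1 + q.2.1

/-- Position numbers are `< 3s`. [cite: BlaserIkenmeyerJindalLysikov2018, §5 (proof of Thm. 23, ECCC p. 14)] -/
theorem posOf_lt (ht : 0 < tN φ) (q : Fin (phi3 ht).length × Fin 3) : posOf ht q < 3 * φ.length := by
  have h1 : q.1.1 < φ.length := by simpa using q.1.2
  have h2 := q.2.2
  unfold posOf; omega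

/-- `slotOf` inverts `posOf`. [cite: BlaserIkenmeyerJindalLysikov2018, §5 (proof of Thm. 23, ECCC p. 14)] -/
theorem slotOf_posOf (ht : 0 < tN φ) (q : Fin (phi3 ht).length × Fin 3) :
    slotOf ht (posOf ht q) (posOf_lt ht q) = q := by
  have h2 := q.2.2
  unfold slotOf posOf
  refine Prod.ext (Fin.ext ?_) (Fin.ext ?_)
  · simp; omega
  · simp

/-- `posOf` inverts `slotOf`. [cite: BlaserIkenmeyerJindalLysikov2018, §5 (proof of Thm. 23, ECCC p. 14)] -/
theorem posOf_slotOf (ht : 0 < tN φ) (u : ℕ) (hu : u < 3 * φ.length) : posOf ht (slotOf ht u hu) = u := by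
  unfold slotOf posOf; simp only; omega

/-- `slotOf` inverts `posOf` (dependent form). [cite: BlaserIkenmeyerJindalLysikov2018, §5 (proof of Thm. 23, ECCC p. 14)] -/
theorem slotOf_eq_of_eq_posOf (ht : 0 < tN φ) {u : ℕ} {hu : u < 3 * φ.length} {q : Fin (phi3 ht).length × Fin 3}
    (h : u = posOf ht q) : slotOf ht u hu = q := by
  subst h; exact slotOf_posOf ht q

/-- Ranks of occurring positions are `< t`. [cite: BlaserIkenmeyerJindalLysikov2018, §5 (proof of Thm. 23, ECCC p. 14)] -/
theorem rk_varAt_lt (hE : φ.IsExactWidth 3) {j a : ℕ} (hj : j < φ.length) (ha : a < 3) :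
    rk φ (varAt φ j a) < tN φ :=
  rk_lt φ (litAt_fst_mem_vlist hE hj ha)

/-- The renamed variable of an occurring position, as a number. [cite: BlaserIkenmeyerJindalLysikov2018, §5 (proof of Thm. 23, ECCC p. 14)] -/
theorem finVar_varAt_val (hE : φ.IsExactWidth 3) (ht : 0 < tN φ) {j a : ℕ} (hj : j < φ.length) (ha : a < 3) :
    ((finVar ht (varAt φ j a) : Fin (tN φ)) : ℕ) = rk φ (varAt φ j a) := by
  simp only [finVar, dif_pos (rk_varAt_lt hE hj ha)]

/-- The literal variable at the slot of position `u`. [cite: BlaserIkenmeyerJindalLysikov2018, §5 (proof of Thm. 23, ECCC p. 14)] -/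
theorem lit_slotOf (hE : φ.IsExactWidth 3) (ht : 0 < tN φ) (u : ℕ) (hu : u < 3 * φ.length) :
    (((phi3 ht).get (slotOf ht u hu).1).lit (slotOf ht u hu).2).1 = finVar ht (varAt φ (u / 3) (u % 3)) := by
  apply Fin.ext
  rw [phi3_lit_fst_val hE, finVar_varAt_val hE ht (by omega) (Nat.mod_lt _ (by norm_num))]
  rfl

/-- **The auxiliary slice index of the `k`-th auxiliary pair.** [cite: BlaserIkenmeyerJindalLysikov2018, §5 (proof of Thm. 23, ECCC p. 14)] -/
def auxOf (hE : φ.IsExactWidth 3) (ht : 0 < tN φ) (k : Fin (nA φ)) :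
    Σ x : Fin (tN φ), {pp : Occ (phi3 ht) x × Occ (phi3 ht) x // pp.1 ≠ pp.2} :=
  have h := (mem_auxPairs φ).1 (List.getElem_mem k.2 : (auxPairs φ)[k.1]'k.2 ∈ auxPairs φ)
  ⟨finVar ht (varAt φ (((auxPairs φ)[k.1]'k.2).1 / 3) (((auxPairs φ)[k.1]'k.2).1 % 3)),
    ⟨(⟨slotOf ht ((auxPairs φ)[k.1]'k.2).1 h.1, lit_slotOf hE ht _ h.1⟩,
      ⟨slotOf ht ((auxPairs φ)[k.1]'k.2).2 h.2.1, by rw [lit_slotOf hE ht _ h.2.1, ← h.2.2.2]⟩),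
    fun heq => h.2.2.1 (by
      have := congrArg (fun o : Occ (phi3 ht) _ => posOf ht o.1) heq
      simpa [posOf_slotOf] using this)⟩⟩


/-- Extensionality for auxiliary slice indices: determined by the two slots. [folklore] -/
private theorem aux_ext {t' : ℕ} {ψ : List (Clause₃ t')} {σ σ' : Σ x : Fin t', {pp : Occ ψ x × Occ ψ x // pp.1 ≠ pp.2}}
    (h1 : σ.2.1.1.1 = σ'.2.1.1.1) (h2 : σ.2.1.2.1 = σ'.2.1.2.1) : σ = σ' := by
  obtain ⟨x, ⟨⟨h, l⟩, hne⟩⟩ := σ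
  obtain ⟨x', ⟨⟨h', l'⟩, hne'⟩⟩ := σ'
  simp only at h1 h2
  have hx : x = x' := by rw [← h.2, ← h'.2, h1]
  subst hx
  have hh : h = h' := Subtype.ext h1
  have hl : l = l' := Subtype.ext h2
  subst hh; subst hl
  rfl

/-- Components of a position number. [cite: BlaserIkenmeyerJindalLysikov2018, §5 (proof of Thm. 23, ECCC p. 14)] -/
theorem posOf_div (ht : 0 < tN φ) (q : Fin (phi3 ht).length × Fin 3) : posOf ht q / 3 = q.1.1 := by
  have := q.2.2; unfold posOf; omega

/-- Components of a position number. [cite: BlaserIkenmeyerJindalLysikov2018, §5 (proof of Thm. 23, ECCC p. 14)] -/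
theorem posOf_mod (ht : 0 < tN φ) (q : Fin (phi3 ht).length × Fin 3) : posOf ht q % 3 = q.2.1 := by
  have := q.2.2; unfold posOf; omega

/-- The slots of `auxOf k` are those of the `k`-th auxiliary pair. [cite: BlaserIkenmeyerJindalLysikov2018, §5 (proof of Thm. 23, ECCC p. 14)] -/
theorem auxOf_fst (hE : φ.IsExactWidth 3) (ht : 0 < tN φ) (k : Fin (nA φ)) :
    (auxOf hE ht k).2.1.1.1 = slotOf ht ((auxPairs φ)[k.1]'k.2).1 ((mem_auxPairs φ).1 (List.getElem_mem k.2)).1 := rfl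

/-- The slots of `auxOf k` are those of the `k`-th auxiliary pair. [cite: BlaserIkenmeyerJindalLysikov2018, §5 (proof of Thm. 23, ECCC p. 14)] -/
theorem auxOf_snd (hE : φ.IsExactWidth 3) (ht : 0 < tN φ) (k : Fin (nA φ)) :
    (auxOf hE ht k).2.1.2.1 = slotOf ht ((auxPairs φ)[k.1]'k.2).2 ((mem_auxPairs φ).1 (List.getElem_mem k.2)).2.1 := rfl

/-- **`auxOf` is a bijection** onto the auxiliary slice indices. [cite: BlaserIkenmeyerJindalLysikov2018, §5 (proof of Thm. 23, ECCC p. 14)] -/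
theorem auxOf_bijective (hE : φ.IsExactWidth 3) (ht : 0 < tN φ) : Function.Bijective (auxOf hE ht) := by
  constructor
  · intro k₁ k₂ h
    have e1 := congrArg (fun σ : (Σ x : Fin (tN φ), {pp : Occ (phi3 ht) x × Occ (phi3 ht) x // pp.1 ≠ pp.2}) =>
      posOf ht σ.2.1.1.1) h
    have e2 := congrArg (fun σ : (Σ x : Fin (tN φ), {pp : Occ (phi3 ht) x × Occ (phi3 ht) x // pp.1 ≠ pp.2}) =>
      posOf ht σ.2.1.2.1) h
    simp only [auxOf_fst, auxOf_snd, posOf_slotOf] at e1 e2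
    exact Fin.ext (((nodup_auxPairs φ).getElem_inj_iff).1 (Prod.ext e1 e2))
  · intro σ
    set q : ℕ × ℕ := (posOf ht σ.2.1.1.1, posOf ht σ.2.1.2.1) with hq
    have hmem : q ∈ auxPairs φ := by
      rw [mem_auxPairs]
      refine ⟨posOf_lt ht _, posOf_lt ht _, fun h => σ.2.2 (Subtype.ext ?_), ?_⟩
      · rw [← slotOf_posOf ht σ.2.1.1.1, ← slotOf_posOf ht σ.2.1.2.1]
        simp only [hq] at h
        simp only [h]
      · simp only [hq, posOf_div, posOf_mod]
        have h1 := σ.2.1.1.2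
        have h2 := σ.2.1.2.2
        have hv1 := congrArg Fin.val h1
        have hv2 := congrArg Fin.val h2
        rw [phi3_lit_fst_val hE] at hv1 hv2
        have hj1 : (σ.2.1.1.1.1 : ℕ) < φ.length := by simpa using σ.2.1.1.1.1.2
        exact rk_injOn φ (litAt_fst_mem_vlist hE hj1 σ.2.1.1.1.2.2) (hv1.trans hv2.symm)
    obtain ⟨k, hk, hkq⟩ := List.getElem_of_mem hmem
    refine ⟨⟨k, hk⟩, aux_ext ?_ ?_⟩
    · rw [auxOf_fst]
      exact slotOf_eq_of_eq_posOf ht (by show ((auxPairs φ)[k]'hk).1 = _; rw [hkq])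
    · rw [auxOf_snd]
      exact slotOf_eq_of_eq_posOf ht (by show ((auxPairs φ)[k]'hk).2 = _; rw [hkq])

/-- The numbering of the auxiliary slices. [cite: BlaserIkenmeyerJindalLysikov2018, §5 (proof of Thm. 23, ECCC p. 14)] -/
def auxEquiv (hE : φ.IsExactWidth 3) (ht : 0 < tN φ) :
    Fin (nA φ) ≃ (Σ x : Fin (tN φ), {pp : Occ (phi3 ht) x × Occ (phi3 ht) x // pp.1 ≠ pp.2}) :=
  Equiv.ofBijective (auxOf hE ht) (auxOf_bijective hE ht)

/-- The numbering of the local slices: `9j + 3a + wh ↦ (j, a, wh)`. [cite: BlaserIkenmeyerJindalLysikov2018, §5 (proof of Thm. 23, ECCC p. 14)] -/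
def locEquiv (ht : 0 < tN φ) : Fin (φ.length * 9) ≃ Fin (phi3 ht).length × Fin 3 × Fin 3 :=
  finProdFinEquiv.symm.trans (Equiv.prodCongr (finCongr (length_phi3 ht).symm)
    ((finCongr (show 9 = 3 * 3 by norm_num)).trans finProdFinEquiv.symm))

/-- First component of `finProdFinEquiv.symm` as a number. [folklore] -/
private theorem finProdFinEquiv_symm_fst_val {m n : ℕ} (x : Fin (m * n)) : ((finProdFinEquiv.symm x).1 : ℕ) = x / n := by
  rw [finProdFinEquiv_symm_apply]; exact Fin.coe_divNat x

/-- Second component of `finProdFinEquiv.symm` as a number. [folklore] -/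
private theorem finProdFinEquiv_symm_snd_val {m n : ℕ} (x : Fin (m * n)) : ((finProdFinEquiv.symm x).2 : ℕ) = x % n := by
  rw [finProdFinEquiv_symm_apply]; exact Fin.coe_modNat x

/-- The clause of local slice number `k`: `k / 9`. [cite: BlaserIkenmeyerJindalLysikov2018, §5 (proof of Thm. 23, ECCC p. 14)] -/
theorem locEquiv_fst (ht : 0 < tN φ) (k : Fin (φ.length * 9)) : ((locEquiv ht k).1 : ℕ) = k.1 / 9 := by
  show ((finCongr (length_phi3 ht).symm (finProdFinEquiv.symm k).1 : Fin _) : ℕ) = k.1 / 9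
  rw [finCongr_apply_coe, finProdFinEquiv_symm_fst_val]

/-- The literal slot of local slice number `k`: `k % 9 / 3`. [cite: BlaserIkenmeyerJindalLysikov2018, §5 (proof of Thm. 23, ECCC p. 14)] -/
theorem locEquiv_snd_fst (ht : 0 < tN φ) (k : Fin (φ.length * 9)) : ((locEquiv ht k).2.1 : ℕ) = k.1 % 9 / 3 := by
  show ((finProdFinEquiv.symm (finCongr (show 9 = 3 * 3 by norm_num) (finProdFinEquiv.symm k).2)).1 : ℕ) = k.1 % 9 / 3
  rw [finProdFinEquiv_symm_fst_val, finCongr_apply_coe, finProdFinEquiv_symm_snd_val]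

/-- The kind of local slice number `k`: `k % 9 % 3`. [cite: BlaserIkenmeyerJindalLysikov2018, §5 (proof of Thm. 23, ECCC p. 14)] -/
theorem locEquiv_snd_snd (ht : 0 < tN φ) (k : Fin (φ.length * 9)) : ((locEquiv ht k).2.2 : ℕ) = k.1 % 9 % 3 := by
  show ((finProdFinEquiv.symm (finCongr (show 9 = 3 * 3 by norm_num) (finProdFinEquiv.symm k).2)).2 : ℕ) = k.1 % 9 % 3
  rw [finProdFinEquiv_symm_snd_val, finCongr_apply_coe, finProdFinEquiv_symm_snd_val]

/-- **The numbering of all slices of `T_φ`** by `Fin m`, `m = t + 9s + |aux|`: formula variables first,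
then the local variables, then the auxiliary variables. [cite: BlaserIkenmeyerJindalLysikov2018, §5 (proof of Thm. 23, ECCC p. 14)] -/
def gEquiv (hE : φ.IsExactWidth 3) (ht : 0 < tN φ) : Fin (mOf φ) ≃ SliceIdx (phi3 ht) :=
  finSumFinEquiv.symm.trans (Equiv.sumCongr (Equiv.refl _)
    (finSumFinEquiv.symm.trans (Equiv.sumCongr (locEquiv ht) (auxEquiv hE ht))))

/-- Slice numbers `< t` are the formula variables. [cite: BlaserIkenmeyerJindalLysikov2018, §5 (proof of Thm. 23, ECCC p. 14)] -/
theorem gEquiv_castAdd (hE : φ.IsExactWidth 3) (ht : 0 < tN φ) (i : ℕ) (hi : i < tN φ) :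
    gEquiv hE ht (Fin.castAdd _ ⟨i, hi⟩) = Sum.inl ⟨i, hi⟩ := by
  simp only [gEquiv, Equiv.trans_apply, finSumFinEquiv_symm_apply_castAdd, Equiv.sumCongr_apply, Sum.map_inl,
    Equiv.refl_apply]

/-- Slice numbers in `[t, t + 9s)` are the local variables. [cite: BlaserIkenmeyerJindalLysikov2018, §5 (proof of Thm. 23, ECCC p. 14)] -/
theorem gEquiv_natAdd_castAdd (hE : φ.IsExactWidth 3) (ht : 0 < tN φ) (i : ℕ) (hi : i < φ.length * 9) :
    gEquiv hE ht (Fin.natAdd (tN φ) (Fin.castAdd (nA φ) ⟨i, hi⟩)) = Sum.inr (Sum.inl (locEquiv ht ⟨i, hi⟩)) := by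
  simp only [gEquiv, Equiv.trans_apply, finSumFinEquiv_symm_apply_natAdd, Equiv.sumCongr_apply, Sum.map_inr,
    finSumFinEquiv_symm_apply_castAdd, Sum.map_inl]

/-- Slice numbers `≥ t + 9s` are the auxiliary variables. [cite: BlaserIkenmeyerJindalLysikov2018, §5 (proof of Thm. 23, ECCC p. 14)] -/
theorem gEquiv_natAdd_natAdd (hE : φ.IsExactWidth 3) (ht : 0 < tN φ) (i : ℕ) (hi : i < nA φ) :
    gEquiv hE ht (Fin.natAdd (tN φ) (Fin.natAdd (φ.length * 9) ⟨i, hi⟩)) = Sum.inr (Sum.inr (auxOf hE ht ⟨i, hi⟩)) := by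
  simp only [gEquiv, auxEquiv, Equiv.trans_apply, finSumFinEquiv_symm_apply_natAdd, Equiv.sumCongr_apply, Sum.map_inr,
    Equiv.ofBijective_apply]

/-- The numbering of the rows/columns: `(j, r) ↦ 9j + r`. [cite: BlaserIkenmeyerJindalLysikov2018, §5 (proof of Thm. 23, ECCC p. 14)] -/
def eRow (ht : 0 < tN φ) : Fin (phi3 ht).length × Fin 9 ≃ Fin (nOfT φ) :=
  (Equiv.prodCongr (finCongr (length_phi3 ht)) (Equiv.refl _)).trans
    (finProdFinEquiv.trans (finCongr (show φ.length * 9 = nOfT φ from rfl)))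

/-- The clause of row number `I`: `I / 9`. [cite: BlaserIkenmeyerJindalLysikov2018, §5 (proof of Thm. 23, ECCC p. 14)] -/
theorem eRow_symm_fst (ht : 0 < tN φ) (i : Fin (nOfT φ)) : (((eRow ht).symm i).1 : ℕ) = i.1 / 9 := by
  simp [eRow, finProdFinEquiv_symm_apply, Fin.coe_divNat]

/-- The local index of row number `I`: `I % 9`. [cite: BlaserIkenmeyerJindalLysikov2018, §5 (proof of Thm. 23, ECCC p. 14)] -/
theorem eRow_symm_snd (ht : 0 < tN φ) (i : Fin (nOfT φ)) : (((eRow ht).symm i).2 : ℕ) = i.1 % 9 := by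
  simp [eRow, finProdFinEquiv_symm_apply, Fin.coe_modNat]


/-! ### The entry list realises the reindexed `T_φ` -/

/-- Local-index arithmetic: the first condition of `tphiA₀`. [cite: BlaserIkenmeyerJindalLysikov2018, §5 (proof of Thm. 23, ECCC p. 14)] -/
theorem cond_varRowCol_iff (r r' : Fin 9) :
    (∃ a : Fin 3, (r = varRow a ∨ r = varCol a) ∧ r' = varRow a) ↔
      (r'.val % 2 = 0 ∧ r'.val ≤ 4 ∧ (r.val = r'.val ∨ r.val = r'.val + 1)) := by
  revert r r'; decide

/-- Local-index arithmetic: the second condition of `tphiA₀`. [cite: BlaserIkenmeyerJindalLysikov2018, §5 (proof of Thm. 23, ECCC p. 14)] -/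
theorem cond_67_iff (r r' : Fin 9) :
    ((r = 6 ∧ r' = 7) ∨ (r = 7 ∧ r' = 8)) ↔ ((r.val = 6 ∧ r'.val = 7) ∨ (r.val = 7 ∧ r'.val = 8)) := by
  revert r r'; decide

/-- Local-index arithmetic: the clause-row condition. [cite: BlaserIkenmeyerJindalLysikov2018, §5 (proof of Thm. 23, ECCC p. 14)] -/
theorem cond_clauseRow_iff (Q : ℕ → Prop) (r r' : Fin 9) :
    (∃ a : Fin 3, r = clauseRow a ∧ r' = clauseRow a ∧ Q a.val) ↔ (r.val = r'.val ∧ 6 ≤ r.val ∧ Q (r.val - 6)) := by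
  constructor
  · rintro ⟨a, h1, h2, h3⟩
    have e1 := (eq_clauseRow_iff r a).1 h1
    have e2 := (eq_clauseRow_iff r' a).1 h2
    refine ⟨by omega, by omega, ?_⟩
    rwa [show r.val - 6 = a.val by omega]
  · rintro ⟨h1, h2, h3⟩
    have hr := r.2
    refine ⟨⟨r.val - 6, by omega⟩, (eq_clauseRow_iff _ _).2 (by simp; omega), (eq_clauseRow_iff _ _).2 (by simp; omega), h3⟩

/-- Local-index arithmetic: variable rows. [cite: BlaserIkenmeyerJindalLysikov2018, §5 (proof of Thm. 23, ECCC p. 14)] -/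
theorem cond_varRow_iff (Q : ℕ → Prop) (r : Fin 9) :
    (∃ a : Fin 3, Q a.val ∧ r = varRow a) ↔ (r.val % 2 = 0 ∧ r.val ≤ 4 ∧ Q (r.val / 2)) := by
  constructor
  · rintro ⟨a, hQ, hr⟩
    have e := (eq_varRow_iff r a).1 hr
    have ha := a.2
    refine ⟨by omega, by omega, ?_⟩
    rwa [show r.val / 2 = a.val by omega]
  · rintro ⟨h1, h2, h3⟩
    exact ⟨⟨r.val / 2, by omega⟩, h3, (eq_varRow_iff _ _).2 (by simp; omega)⟩

/-- Local-index arithmetic: variable columns. [cite: BlaserIkenmeyerJindalLysikov2018, §5 (proof of Thm. 23, ECCC p. 14)] -/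
theorem cond_varCol_iff (Q : ℕ → Prop) (r : Fin 9) :
    (∃ a : Fin 3, Q a.val ∧ r = varCol a) ↔ (r.val % 2 = 1 ∧ r.val ≤ 5 ∧ Q (r.val / 2)) := by
  constructor
  · rintro ⟨a, hQ, hr⟩
    have e := (eq_varCol_iff r a).1 hr
    have ha := a.2
    refine ⟨by omega, by omega, ?_⟩
    rwa [show r.val / 2 = a.val by omega]
  · rintro ⟨h1, h2, h3⟩
    have hr := r.2
    exact ⟨⟨r.val / 2, by omega⟩, h3, (eq_varCol_iff _ _).2 (by simp; omega)⟩

/-- The polarity of the literal of `phi3` in slot `(j, a)`. [cite: BlaserIkenmeyerJindalLysikov2018, §5 (proof of Thm. 23, ECCC p. 14)] -/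
theorem phi3_lit_snd (ht : 0 < tN φ) (j : Fin (phi3 ht).length) (a : Fin 3) :
    (((phi3 ht).get j).lit a).2 = (litAt φ j.1 a.1).2 := by
  rw [phi3_lit]; rfl

variable (K : Type u) [Field K]

/-- **The constant slice read from the entry list is the reindexed `A₀` of `T_φ`.** [cite: BlaserIkenmeyerJindalLysikov2018, §5 (proof of Thm. 23, ECCC p. 14)] -/
theorem slice₀OfList_entriesT (ht : 0 < tN φ) :
    slice₀OfList K (nOfT φ) (entriesT φ) = (tphiA₀ K (phi3 ht)).reindex (eRow ht) (eRow ht) := by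
  ext i j
  have h := getD_entriesT φ (h := 0) (Nat.zero_le _) i.2 j.2
  rw [zero_mul, zero_add] at h
  rw [slice₀OfList, h, entryT, if_pos rfl, Matrix.reindex_apply, Matrix.submatrix_apply, tphiA₀]
  have e1 := eRow_symm_fst ht i
  have e2 := eRow_symm_snd ht i
  have f1 := eRow_symm_fst ht j
  have f2 := eRow_symm_snd ht j
  set p := (eRow ht).symm i
  set q := (eRow ht).symm j
  have c1 : p.1 = q.1 ↔ i.1 / 9 = j.1 / 9 := by rw [Fin.ext_iff, e1, f1]
  have c2 := cond_varRowCol_iff p.2 q.2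
  have c3 := cond_67_iff p.2 q.2
  have c4 := cond_clauseRow_iff (fun n => (litAt φ (i.1 / 9) n).2 = true) p.2 q.2
  simp only [phi3_lit_snd, e1] at c4 ⊢
  rw [e2, f2] at c2 c3 c4
  simp only [a0T]
  by_cases k1 : p.1 = q.1
  · rw [if_pos k1, if_pos (c1.1 k1)]
    by_cases k2 : ∃ a : Fin 3, (p.2 = varRow a ∨ p.2 = varCol a) ∧ q.2 = varRow a
    · rw [if_pos k2, if_pos (c2.1 k2)]; simp
    · rw [if_neg k2, if_neg (fun h => k2 (c2.2 h))]
      by_cases k3 : (p.2 = 6 ∧ q.2 = 7) ∨ (p.2 = 7 ∧ q.2 = 8)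
      · rw [if_pos k3, if_pos (c3.1 k3)]; simp
      · rw [if_neg k3, if_neg (fun h => k3 (c3.2 h))]
        by_cases k4 : ∃ a : Fin 3, p.2 = clauseRow a ∧ q.2 = clauseRow a ∧ (litAt φ (i.1 / 9) a.1).2 = true
        · rw [if_pos k4, if_pos (c4.1 k4)]; simp
        · rw [if_neg k4, if_neg (fun h => k4 (c4.2 h))]; simp
  · rw [if_neg k1, if_neg (fun h => k1 (c1.2 h))]; simp


/-- The variable of slot `(p.1, a)` equals `⟨x, _⟩` iff the raw rank is `x`. [cite: BlaserIkenmeyerJindalLysikov2018, §5 (proof of Thm. 23, ECCC p. 14)] -/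
theorem lit_fst_eq_iff (hE : φ.IsExactWidth 3) (ht : 0 < tN φ) (j : Fin (phi3 ht).length) (a : Fin 3)
    (x : ℕ) (hx : x < tN φ) : (((phi3 ht).get j).lit a).1 = ⟨x, hx⟩ ↔ rk φ (varAt φ j.1 a.1) = x := by
  rw [Fin.ext_iff, phi3_lit_fst_val hE]

/-- Reading slice `k` of the entry list. [cite: BlaserIkenmeyerJindalLysikov2018, §5 (proof of Thm. 23, ECCC p. 14)] -/
theorem slicesOfList_entriesT_apply (k : Fin (mOf φ)) (i j : Fin (nOfT φ)) :
    slicesOfList K (nOfT φ) (mOf φ) (entriesT φ) k i j = ((sliceT φ k.1 i.1 j.1 : ℤ) : K) := by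
  have h := getD_entriesT φ (h := k.1 + 1) (by have := k.2; omega) i.2 j.2
  rw [slicesOfList, sq, h, entryT, if_neg (Nat.succ_ne_zero _), Nat.add_sub_cancel]

/-- **Slice bridge, formula variables.** [cite: BlaserIkenmeyerJindalLysikov2018, §5 (proof of Thm. 23, ECCC p. 14)] -/
theorem sliceT_var (hE : φ.IsExactWidth 3) (ht : 0 < tN φ) (x : ℕ) (hx : x < tN φ) (i j : Fin (nOfT φ)) :
    ((sliceT φ x i.1 j.1 : ℤ) : K) =
      tphiSlices K (phi3 ht) (Sum.inl ⟨x, hx⟩) ((eRow ht).symm i) ((eRow ht).symm j) := by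
  rw [sliceT, if_pos hx, TPhiRank.slice_inl_apply, xT]
  have e1 := eRow_symm_fst ht i
  have e2 := eRow_symm_snd ht i
  have f1 := eRow_symm_fst ht j
  have f2 := eRow_symm_snd ht j
  set p := (eRow ht).symm i
  set q := (eRow ht).symm j
  have c1 := cond_varRow_iff (fun a => rk φ (varAt φ (i.1 / 9) a) = x) p.2
  have c2 := cond_varCol_iff (fun a => rk φ (varAt φ (j.1 / 9) a) = x) q.2
  simp only [lit_fst_eq_iff hE, e1, f1]
  rw [e2] at c1
  rw [f2] at c2
  by_cases k1 : (∃ a : Fin 3, rk φ (varAt φ (i.1 / 9) a.1) = x ∧ p.2 = varRow a) ∧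
      (∃ a : Fin 3, rk φ (varAt φ (j.1 / 9) a.1) = x ∧ q.2 = varCol a)
  · rw [if_pos k1, if_pos ⟨c1.1 k1.1, c2.1 k1.2⟩]; simp
  · rw [if_neg k1, if_neg (fun h => k1 ⟨c1.2 h.1, c2.2 h.2⟩)]; simp

/-- **Slice bridge, local variables.** [cite: BlaserIkenmeyerJindalLysikov2018, §5 (proof of Thm. 23, ECCC p. 14)] -/
theorem sliceT_loc (ht : 0 < tN φ) (k' : ℕ) (hk' : k' < φ.length * 9) (i j : Fin (nOfT φ)) :
    ((sliceT φ (tN φ + k') i.1 j.1 : ℤ) : K) =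
      tphiSlices K (phi3 ht) (Sum.inr (Sum.inl (locEquiv ht ⟨k', hk'⟩))) ((eRow ht).symm i) ((eRow ht).symm j) := by
  rw [sliceT, if_neg (by omega), if_pos (by omega), Nat.add_sub_cancel_left]
  have e1 := eRow_symm_fst ht i
  have e2 := eRow_symm_snd ht i
  have f1 := eRow_symm_fst ht j
  have f2 := eRow_symm_snd ht j
  have g1 := locEquiv_fst ht ⟨k', hk'⟩
  have g2 := locEquiv_snd_fst ht ⟨k', hk'⟩
  have g3 := locEquiv_snd_snd ht ⟨k', hk'⟩
  set p := (eRow ht).symm i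
  set q := (eRow ht).symm j
  set jj := (locEquiv ht ⟨k', hk'⟩).1
  set aa := (locEquiv ht ⟨k', hk'⟩).2.1
  set wh := (locEquiv ht ⟨k', hk'⟩).2.2
  have htrip : locEquiv ht ⟨k', hk'⟩ = (jj, aa, wh) := rfl
  have c0 : (p.1 = jj ∧ q.1 = jj) ↔ (i.1 / 9 = k' / 9 ∧ j.1 / 9 = k' / 9) := by
    rw [Fin.ext_iff, Fin.ext_iff, e1, f1, g1]
  have cpc : p.2 = varCol aa ↔ i.1 % 9 = 2 * (k' % 9 / 3) + 1 := by rw [eq_varCol_iff, e2, g2]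
  have cpr : p.2 = clauseRow aa ↔ i.1 % 9 = 6 + k' % 9 / 3 := by rw [eq_clauseRow_iff, e2, g2]
  have cqc : q.2 = varCol aa ↔ j.1 % 9 = 2 * (k' % 9 / 3) + 1 := by rw [eq_varCol_iff, f2, g2]
  have cqr : q.2 = clauseRow aa ↔ j.1 % 9 = 6 + k' % 9 / 3 := by rw [eq_clauseRow_iff, f2, g2]
  have hpol : (((phi3 ht).get jj).lit aa).2 = (litAt φ (k' / 9) (k' % 9 / 3)).2 := by rw [phi3_lit_snd, g1, g2]
  rw [htrip, locT]
  by_cases k0 : p.1 = jj ∧ q.1 = jj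
  · rw [if_pos (c0.1 k0)]
    have hw3 : k' % 9 % 3 < 3 := Nat.mod_lt _ (by norm_num)
    rcases TPhiRank_fin3 wh with hw | hw | hw
    · have hw0 : k' % 9 % 3 = 0 := by rw [← g3, hw]; rfl
      rw [hw, TPhiRank.slice_loc0_apply, if_pos k0, if_pos hw0, hpol]
      by_cases k1 : p.2 = varCol aa ∨ p.2 = clauseRow aa
      · rw [if_pos k1, if_pos (k1.imp cpc.1 cpr.1)]
        by_cases k2 : q.2 = varCol aa
        · rw [if_pos k2, if_pos (cqc.1 k2)]; simp
        · rw [if_neg k2, if_neg (fun h => k2 (cqc.2 h))]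
          by_cases k3 : q.2 = clauseRow aa
          · rw [if_pos k3, if_pos (cqr.1 k3)]; split_ifs <;> simp
          · rw [if_neg k3, if_neg (fun h => k3 (cqr.2 h))]; simp
      · rw [if_neg k1, if_neg (fun h => k1 (h.imp cpc.2 cpr.2))]; simp
    · have hw1 : k' % 9 % 3 = 1 := by rw [← g3, hw]; rfl
      rw [hw, TPhiRank.slice_loc1_apply, if_pos k0, if_neg (by omega), if_pos hw1]
      by_cases k1 : p.2 = varCol aa ∧ q.2 = clauseRow aa
      · rw [if_pos k1, if_pos ⟨cpc.1 k1.1, cqr.1 k1.2⟩]; simp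
      · rw [if_neg k1, if_neg (fun h => k1 ⟨cpc.2 h.1, cqr.2 h.2⟩)]; simp
    · have hw2 : k' % 9 % 3 = 2 := by rw [← g3, hw]; rfl
      rw [hw, TPhiRank.slice_loc2_apply, if_pos k0, if_neg (by omega), if_neg (by omega)]
      by_cases k1 : p.2 = clauseRow aa ∧ q.2 = varCol aa
      · rw [if_pos k1, if_pos ⟨cpr.1 k1.1, cqc.1 k1.2⟩]; simp
      · rw [if_neg k1, if_neg (fun h => k1 ⟨cpr.2 h.1, cqc.2 h.2⟩)]; simp
  · rw [if_neg (fun h => k0 (c0.2 h))]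
    rcases TPhiRank_fin3 wh with hw | hw | hw
    · rw [hw, TPhiRank.slice_loc0_apply, if_neg k0]; simp
    · rw [hw, TPhiRank.slice_loc1_apply, if_neg k0]; simp
    · rw [hw, TPhiRank.slice_loc2_apply, if_neg k0]; simp

/-- **Slice bridge, auxiliary variables.** [cite: BlaserIkenmeyerJindalLysikov2018, §5 (proof of Thm. 23, ECCC p. 14)] -/
theorem sliceT_aux (hE : φ.IsExactWidth 3) (ht : 0 < tN φ) (k'' : ℕ) (hk'' : k'' < nA φ) (i j : Fin (nOfT φ)) :
    ((sliceT φ (tN φ + φ.length * 9 + k'') i.1 j.1 : ℤ) : K) =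
      tphiSlices K (phi3 ht) (Sum.inr (Sum.inr (auxOf hE ht ⟨k'', hk''⟩))) ((eRow ht).symm i) ((eRow ht).symm j) := by
  rw [sliceT, if_neg (by omega), if_neg (by omega), show tN φ + φ.length * 9 + k'' - tN φ - φ.length * 9 = k'' by omega,
    List.getD_eq_getElem _ _ (by unfold nA at hk''; exact hk''), tphiSlices_aux_apply, auxOf_fst, auxOf_snd, auxT]
  have e1 := eRow_symm_fst ht i
  have e2 := eRow_symm_snd ht i
  have f1 := eRow_symm_fst ht j
  have f2 := eRow_symm_snd ht j
  set p := (eRow ht).symm i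
  set q := (eRow ht).symm j
  have hmem := (mem_auxPairs φ).1 (List.getElem_mem hk'' : (auxPairs φ)[k'']'hk'' ∈ auxPairs φ)
  set uu := (auxPairs φ)[k'']'hk''
  have hi := i.2
  have hj := j.2
  have cc : (p = ((slotOf ht uu.1 hmem.1).1, varRow (slotOf ht uu.1 hmem.1).2) ∧
      q = ((slotOf ht uu.2 hmem.2.1).1, varCol (slotOf ht uu.2 hmem.2.1).2)) ↔
      (i.1 = 9 * (uu.1 / 3) + 2 * (uu.1 % 3) ∧ j.1 = 9 * (uu.2 / 3) + (2 * (uu.2 % 3) + 1)) := by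
    simp only [Prod.ext_iff, eq_varRow_iff, eq_varCol_iff]
    simp only [Fin.ext_iff, e1, e2, f1, f2, slotOf, Fin.val_mk]
    omega
  by_cases k1 : p = ((slotOf ht uu.1 hmem.1).1, varRow (slotOf ht uu.1 hmem.1).2) ∧
      q = ((slotOf ht uu.2 hmem.2.1).1, varCol (slotOf ht uu.2 hmem.2.1).2)
  · rw [if_pos k1, if_pos (cc.1 k1)]; simp
  · rw [if_neg k1, if_neg (fun h => k1 (cc.2 h))]; simp

/-- **The slices read from the entry list are the reindexed, renumbered slices of `T_φ`.** [cite: BlaserIkenmeyerJindalLysikov2018, §5 (proof of Thm. 23, ECCC p. 14)] -/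
theorem slicesOfList_entriesT (hE : φ.IsExactWidth 3) (ht : 0 < tN φ) :
    slicesOfList K (nOfT φ) (mOf φ) (entriesT φ) =
      fun k => (tphiSlices K (phi3 ht) (gEquiv hE ht k)).reindex (eRow ht) (eRow ht) := by
  funext k
  ext i j
  rw [slicesOfList_entriesT_apply, Matrix.reindex_apply, Matrix.submatrix_apply]
  obtain ⟨kv, hk⟩ := k
  by_cases h1 : kv < tN φ
  · rw [show (⟨kv, hk⟩ : Fin (mOf φ)) = Fin.castAdd _ ⟨kv, h1⟩ from rfl, gEquiv_castAdd]
    exact sliceT_var K hE ht kv h1 i j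
  · by_cases h2 : kv < tN φ + φ.length * 9
    · have hk' : kv - tN φ < φ.length * 9 := by omega
      have hg := gEquiv_natAdd_castAdd hE ht (kv - tN φ) hk'
      rw [show Fin.natAdd (tN φ) (Fin.castAdd (nA φ) ⟨kv - tN φ, hk'⟩) = (⟨kv, hk⟩ : Fin (mOf φ)) from
        Fin.ext (by simp; omega)] at hg
      rw [hg]
      have := sliceT_loc K ht (kv - tN φ) hk' i j
      rwa [show tN φ + (kv - tN φ) = kv by omega] at this
    · have hk'' : kv - tN φ - φ.length * 9 < nA φ := by unfold mOf at hk; omega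
      have hg := gEquiv_natAdd_natAdd hE ht (kv - tN φ - φ.length * 9) hk''
      rw [show Fin.natAdd (tN φ) (Fin.natAdd (φ.length * 9) ⟨kv - tN φ - φ.length * 9, hk''⟩) = (⟨kv, hk⟩ : Fin (mOf φ))
        from Fin.ext (by simp; omega)] at hg
      rw [hg]
      have := sliceT_aux K hE ht (kv - tN φ - φ.length * 9) hk'' i j
      rwa [show tN φ + φ.length * 9 + (kv - tN φ - φ.length * 9) = kv by omega] at this


/-! ### Size bounds -/

/-- Occurrence slots of one renamed variable: at most `3B`. [cite: BlaserIkenmeyerJindalLysikov2018, §5 (proof of Thm. 23, ECCC p. 14)] -/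
theorem card_occ_le (hE : φ.IsExactWidth 3) (ht : 0 < tN φ) {B : ℕ} (hB : ∀ x, φ.varOcc x ≤ B) (y : Fin (tN φ)) :
    Fintype.card (Occ (phi3 ht) y) ≤ 3 * B := by
  classical
  rw [Fintype.card_subtype]
  calc (Finset.univ.filter fun q : Fin (phi3 ht).length × Fin 3 => (((phi3 ht).get q.1).lit q.2).1 = y).card
      ≤ ((Finset.univ.filter fun j : Fin (phi3 ht).length => ∃ a : Fin 3, (((phi3 ht).get j).lit a).1 = y) ×ˢ
          (Finset.univ : Finset (Fin 3))).card := by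
        refine Finset.card_le_card fun q hq => ?_
        rw [Finset.mem_filter] at hq
        exact Finset.mem_product.2 ⟨Finset.mem_filter.2 ⟨Finset.mem_univ _, q.2, hq.2⟩, Finset.mem_univ _⟩
    _ ≤ 3 * B := by
        rw [Finset.card_product, Finset.card_univ, Fintype.card_fin, Nat.mul_comm]
        exact Nat.mul_le_mul_left 3 (card_occ_phi3_le hE ht hB y)

/-- **The number of auxiliary slices is linear**: `|aux| ≤ 9 B s`. [cite: BlaserIkenmeyerJindalLysikov2018, §5 (proof of Thm. 23, ECCC p. 14)] -/
theorem nA_le_lin (hE : φ.IsExactWidth 3) (ht : 0 < tN φ) {B : ℕ} (hB : ∀ x, φ.varOcc x ≤ B) :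
    nA φ ≤ 9 * B * φ.length := by
  classical
  have h1 : nA φ = Fintype.card (Σ x : Fin (tN φ), {pp : Occ (phi3 ht) x × Occ (phi3 ht) x // pp.1 ≠ pp.2}) := by
    rw [← Fintype.card_fin (nA φ)]; exact Fintype.card_congr (auxEquiv hE ht)
  rw [h1, Fintype.card_sigma]
  calc ∑ x, Fintype.card {pp : Occ (phi3 ht) x × Occ (phi3 ht) x // pp.1 ≠ pp.2}
      ≤ ∑ x : Fin (tN φ), Fintype.card (Occ (phi3 ht) x) * (3 * B) := by
        refine Finset.sum_le_sum fun x _ => ?_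
        refine (Fintype.card_subtype_le _).trans ?_
        rw [Fintype.card_prod]
        exact Nat.mul_le_mul_left _ (card_occ_le hE ht hB x)
    _ = (∑ x : Fin (tN φ), Fintype.card (Occ (phi3 ht) x)) * (3 * B) := by rw [Finset.sum_mul]
    _ = Fintype.card (Fin (phi3 ht).length × Fin 3) * (3 * B) := by
        rw [← Fintype.card_sigma,
          Fintype.card_congr (Equiv.sigmaFiberEquiv fun q : Fin (phi3 ht).length × Fin 3 => (((phi3 ht).get q.1).lit q.2).1)]
    _ = 9 * B * φ.length := by
        rw [Fintype.card_prod, Fintype.card_fin, Fintype.card_fin, length_phi3]; ring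

/-- **`m ≤ (12 + 9B) s`.** [cite: BlaserIkenmeyerJindalLysikov2018, §5 (proof of Thm. 23, ECCC p. 14)] -/
theorem mOf_le (hE : φ.IsExactWidth 3) (ht : 0 < tN φ) {B : ℕ} (hB : ∀ x, φ.varOcc x ≤ B) :
    mOf φ ≤ (12 + 9 * B) * φ.length := by
  have h1 := tN_le φ hE.isWidthLE
  have h2 := nA_le_lin hE ht hB
  unfold mOf; nlinarith

/-! ### Correctness of the instance map -/

variable (K : Type u) [Field K]

/-- The tensor rank of the encoded tensor of `instT φ` is that of the renumbered `T_φ`. [cite: BlaserIkenmeyerJindalLysikov2018, §5 (proof of Thm. 23, ECCC p. 14)] -/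
theorem tensorRank_instT (hE : φ.IsExactWidth 3) (ht : 0 < tN φ) :
    tensorRank (slicesTensor K (slice₀OfList K (nOfT φ) (entriesT φ)) (slicesOfList K (nOfT φ) (mOf φ) (entriesT φ))) =
      tensorRank (slicesTensor K ((tphiA₀ K (phi3 ht)).reindex (eRow ht) (eRow ht))
        (fun k => (tphiSlices K (phi3 ht) (gEquiv hE ht k)).reindex (eRow ht) (eRow ht))) := by
  rw [slice₀OfList_entriesT K ht, slicesOfList_entriesT K hE ht]

/-- **Yes side**: satisfiable `φ` gives `R ≤ 5s + m`. [cite: BlaserIkenmeyerJindalLysikov2018, §5 (proof of Thm. 23, ECCC p. 14)] -/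
theorem tensorRank_instT_le (hE : φ.IsExactWidth 3) (hs : 0 < φ.length) (hsat : φ.Satisfiable) :
    tensorRank (slicesTensor K (slice₀OfList K (nOfT φ) (entriesT φ)) (slicesOfList K (nOfT φ) (mOf φ) (entriesT φ))) ≤
      5 * φ.length + mOf φ := by
  have ht := tN_pos hE hs
  rw [tensorRank_instT K hE ht]
  have h := TPhiRank.tensorRank_tphi_le_of_satisfiable (K := K) (phi3 ht) (by rw [length_phi3]; exact hs)
    (exists_lit_eq hE ht) (eRow ht) (gEquiv hE ht) (exists_numSat₃_phi3_eq hE ht hsat)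
  exact h.trans (le_of_eq (by rw [length_phi3]))

/-- The gap parameter: `γ = ε / (2 (B+1) (17 + 9B))`. [cite: BlaserIkenmeyerJindalLysikov2018, §5 (proof of Thm. 23, ECCC p. 14)] -/
def gammaOf (B : ℕ) (ε : ℚ) : ℚ := ε / (2 * ((B : ℚ) + 1) * (17 + 9 * (B : ℚ)))

/-- `γ > 0` for `ε > 0`. [cite: BlaserIkenmeyerJindalLysikov2018, §5 (proof of Thm. 23, ECCC p. 14)] -/
theorem gammaOf_pos (B : ℕ) {ε : ℚ} (hε : 0 < ε) : 0 < gammaOf B ε := by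
  unfold gammaOf; positivity

/-- **No side**: value `≤ 1 - ε` and occurrence bound `B` give `(1 + γ)(5s + m) < R`. [cite: BlaserIkenmeyerJindalLysikov2018, §5 (proof of Thm. 23, ECCC p. 14)] -/
theorem lt_tensorRank_instT (hE : φ.IsExactWidth 3) (hs : 0 < φ.length) {B : ℕ} (hB : ∀ x, φ.varOcc x ≤ B)
    {ε : ℚ} (hε : 0 < ε) (hval : φ.maxSatFraction ≤ 1 - ε) :
    (1 + gammaOf B ε) * ((5 * φ.length + mOf φ : ℕ) : ℚ) <
      (tensorRank (slicesTensor K (slice₀OfList K (nOfT φ) (entriesT φ))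
        (slicesOfList K (nOfT φ) (mOf φ) (entriesT φ))) : ℚ) := by
  have ht := tN_pos hE hs
  rw [tensorRank_instT K hE ht]
  have hgap : ∀ τ : Fin (tN φ) → Bool, (numSat₃ (phi3 ht) τ : ℚ) ≤ (1 - ε) * (phi3 ht).length := by
    intro τ
    rw [length_phi3]
    refine (numSat₃_phi3_le hE ht τ).trans ?_
    exact mul_le_mul_of_nonneg_right hval (by positivity)
  have h := TPhiRank.le_tensorRank_tphi_of_gap (K := K) (phi3 ht) (by rw [length_phi3]; exact hs)
    (exists_lit_eq hE ht) (eRow ht) (gEquiv hE ht) (B + 1) (by omega) (fun y => (card_occ_phi3_le hE ht hB y).trans (by omega))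
    ε hgap
  have h' : (5 + ε / ((B + 1 : ℕ) : ℚ)) * (φ.length : ℚ) + (mOf φ : ℚ) ≤ _ :=
    le_trans (le_of_eq (by rw [length_phi3])) h
  refine lt_of_lt_of_le ?_ h'
  have hm := mOf_le hE ht hB
  have hs1 : (1 : ℚ) ≤ φ.length := by exact_mod_cast hs
  have hmq : (mOf φ : ℚ) ≤ (12 + 9 * B) * φ.length := by exact_mod_cast hm
  have hB0 : (0 : ℚ) ≤ B := by positivity
  push_cast at hmq ⊢
  unfold gammaOf
  set M : ℚ := (tN φ : ℚ) + ((φ.length : ℚ) * 9 + (nA φ : ℚ))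
  set S : ℚ := (φ.length : ℚ)
  have hden : (0 : ℚ) < 2 * ((B : ℚ) + 1) * (17 + 9 * B) := by positivity
  have hB1 : (0 : ℚ) < (B : ℚ) + 1 := by positivity
  have key : ε / (2 * ((B : ℚ) + 1) * (17 + 9 * B)) * (5 * S + M) < ε / ((B : ℚ) + 1) * S := by
    rw [div_mul_eq_mul_div, div_mul_eq_mul_div, div_lt_div_iff₀ hden hB1]
    have h5 : 5 * S + M ≤ (17 + 9 * B) * S := by nlinarith
    have hpos : 0 < ε * ((B : ℚ) + 1) := by positivity
    have h6 := mul_le_mul_of_nonneg_left h5 hpos.le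
    have hpos2 : 0 < ε * ((B : ℚ) + 1) * ((17 + 9 * B) * S) := by positivity
    nlinarith
  have hexp : (1 + ε / (2 * ((B : ℚ) + 1) * (17 + 9 * B))) * (5 * S + M) =
      (5 * S + M) + ε / (2 * ((B : ℚ) + 1) * (17 + 9 * B)) * (5 * S + M) := by ring
  have hexp' : (5 + ε / ((B : ℚ) + 1)) * S + M = (5 * S + M) + ε / ((B : ℚ) + 1) * S := by ring
  rw [hexp, hexp']
  linarith [key]

/-- The fixed yes-instance is well formed with tensor rank `0`. [cite: BlaserIkenmeyerJindalLysikov2018, §5 (proof of Thm. 23, ECCC p. 14)] -/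
theorem yesInst_spec : WellFormedInst yesInst ∧
    tensorRank (slicesTensor K (slice₀OfList K yesInst.1 yesInst.2.2.1)
      (slicesOfList K yesInst.1 yesInst.2.1 yesInst.2.2.1)) ≤ yesInst.2.2.2 := by
  refine ⟨by simp [WellFormedInst, yesInst], ?_⟩
  have : slicesTensor K (slice₀OfList K yesInst.1 yesInst.2.2.1) (slicesOfList K yesInst.1 yesInst.2.1 yesInst.2.2.1) = 0 := by
    funext o i; exact Fin.elim0 (i : Fin 0)
  rw [this, tensorRank_zero]
  exact Nat.zero_le _

/-- Membership of a code in the yes side of `gapTensorRankProblem`. [cite: BlaserIkenmeyerJindalLysikov2018, §5 (proof of Thm. 23, ECCC p. 14)] -/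
theorem encode_mem_gapTensorRank_yes (γ : ℚ) (x : ℕ × ℕ × List ℤ × ℕ) :
    tensorInstEncoding.encode x ∈ (gapTensorRankProblem K γ).yes ↔
      WellFormedInst x ∧ tensorRank (slicesTensor K (slice₀OfList K x.1 x.2.2.1) (slicesOfList K x.1 x.2.1 x.2.2.1)) ≤ x.2.2.2 :=
  tensorInstEncoding.mem_toLanguage_iff _ x

/-- Membership of a code in the no side of `gapTensorRankProblem`. [cite: BlaserIkenmeyerJindalLysikov2018, §5 (proof of Thm. 23, ECCC p. 14)] -/
theorem encode_mem_gapTensorRank_no (γ : ℚ) (x : ℕ × ℕ × List ℤ × ℕ) :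
    tensorInstEncoding.encode x ∈ (gapTensorRankProblem K γ).no ↔
      WellFormedInst x ∧ (1 + γ) * x.2.2.2 <
        (tensorRank (slicesTensor K (slice₀OfList K x.1 x.2.2.1) (slicesOfList K x.1 x.2.1 x.2.2.1)) : ℚ) :=
  tensorInstEncoding.mem_toLanguage_iff _ x

/-- **The reduction** `gapE3SATOcc(B, ε₀) ≤ₚ gapTensorRank(γ)`, given an `FP` realisation of `redT`. [cite: BlaserIkenmeyerJindalLysikov2018, §5 (proof of Thm. 23, ECCC p. 14)] -/
theorem gapE3SATOcc_reducible_gapTensorRank (B : ℕ) {ε₀ : ℚ} (hε₀ : ε₀ < 1 / 8)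
    (hFP : ∃ f ∈ FP, ∀ ψ : CNF ℕ, f (encodingCNF.encode ψ) = tensorInstEncoding.encode (redT ψ)) :
    (gapE3SATOcc B ε₀).PolyTimeReducible (gapTensorRankProblem K (gammaOf B (1 / 8 - ε₀))) := by
  obtain ⟨f, hf, hspec⟩ := hFP
  refine ⟨f, hf, fun w hw => ?_, fun w hw => ?_⟩
  · obtain ⟨ψ, hψ, rfl⟩ := hw
    obtain ⟨hE, hB, hsat⟩ := hψ
    rw [hspec]
    show tensorInstEncoding.encode (redT ψ) ∈ (gapTensorRankProblem K (gammaOf B (1 / 8 - ε₀))).yes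
    rw [encode_mem_gapTensorRank_yes]
    by_cases hs : 0 < ψ.length
    · rw [redT, if_pos ⟨hE, hs⟩]
      exact ⟨wellFormedInst_instT ψ, tensorRank_instT_le K hE hs hsat⟩
    · rw [redT, if_neg (fun h => hs h.2)]
      exact yesInst_spec K
  · obtain ⟨ψ, hψ, rfl⟩ := hw
    obtain ⟨hE, hB, hval⟩ := hψ
    rw [hspec]
    show tensorInstEncoding.encode (redT ψ) ∈ (gapTensorRankProblem K (gammaOf B (1 / 8 - ε₀))).no
    rw [encode_mem_gapTensorRank_no]
    have hs : 0 < ψ.length := by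
      rcases Nat.eq_zero_or_pos ψ.length with h | h
      · exfalso
        rw [List.length_eq_zero_iff.1 h, maxSatFraction_nil] at hval
        linarith
      · exact h
    rw [redT, if_pos ⟨hE, hs⟩]
    refine ⟨wellFormedInst_instT ψ, ?_⟩
    have h := lt_tensorRank_instT K hE hs hB (ε := 1 / 8 - ε₀) (by linarith) (by linarith)
    simpa [instT] using h

/-- **Theorem 23 from an `FP` realisation of the instance map.** [cite: BlaserIkenmeyerJindalLysikov2018, §5 (proof of Thm. 23, ECCC p. 14)] -/
theorem thm23_of_FP (hFP : ∃ f ∈ FP, ∀ ψ : CNF ℕ, f (encodingCNF.encode ψ) = tensorInstEncoding.encode (redT ψ)) :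
    BIJL2018_thm23 K := by
  obtain ⟨B, ε₀, hε₀, hhard⟩ := gapE3SATOcc_isNPHard_some
  exact ⟨gammaOf B (1 / 8 - ε₀), gammaOf_pos B (by linarith),
    PromiseProblem.IsHard.of_reducible_holds hhard (gapE3SATOcc_reducible_gapTensorRank K B hε₀ hFP)⟩


/-! ### The machine: `redT` on codes, in the typed `CodeFP` algebra -/

section Machine

open CodeFP

/-- The raw variable of a slot on codes. [cite: AroraBarak2009, §1.3 (polynomial-time computation on codes)] -/
theorem varAtFP : CodeFP (pairE cnfE (pairE natE natE)) natE (fun p => varAt p.1 p.2.1 p.2.2) :=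
  litAtFP.fst'.congr fun _ => rfl

/-- `(vlist φ).getD p 0` on codes. [cite: AroraBarak2009, §1.3 (polynomial-time computation on codes)] -/
theorem getDVlistFP : CodeFP (pairE cnfE natE) natE (fun q => (vlist q.1).getD q.2 0) :=
  ((rawGetOr natE).comp ((vlistFP.comp (fst _ _)).pair ((snd _ _).pair (const _ (0 : ℕ))))).congr fun _ => rfl

/-- `range |vlist φ|` on codes. [cite: AroraBarak2009, §1.3 (polynomial-time computation on codes)] -/
theorem rangeVlistFP : CodeFP cnfE (rawE natE) (fun φ => List.range (vlist φ).length) :=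
  ((brange natE).comp (vlistFP.pair ((natLength natE).comp vlistFP))).congr fun φ => by simp

/-- `firstPos` on codes. [cite: AroraBarak2009, §1.3 (polynomial-time computation on codes)] -/
theorem firstPosFP : CodeFP cnfE (rawE natE) firstPos := by
  have idxOfFP : CodeFP (pairE natE (rawE natE)) natE (fun q => q.2.idxOf q.1) :=
    (findIdxFP (σ := ℕ) (α := ℕ) (p := fun q => q.2 == q.1)
      ((beq natE_injective).comp ((snd _ _).pair (fst _ _)))).congr fun _ => rfl
  have hp : CodeFP (pairE cnfE natE) bitE (fun q => decide ((vlist q.1).idxOf ((vlist q.1).getD q.2 0) = q.2)) :=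
    (natEq.comp ((idxOfFP.comp (getDVlistFP.pair (vlistFP.comp (fst _ _)))).pair (snd _ _))).congr fun _ => rfl
  exact ((filter hp).comp ((CodeFP.id cnfE).pair rangeVlistFP)).congr fun φ => rfl

/-- `dvars` on codes. [cite: AroraBarak2009, §1.3 (polynomial-time computation on codes)] -/
theorem dvarsFP : CodeFP cnfE (rawE natE) dvars :=
  ((map (σ := CNF ℕ) (g := fun q : CNF ℕ × ℕ => (vlist q.1).getD q.2 0) getDVlistFP).comp
    ((CodeFP.id cnfE).pair firstPosFP)).congr fun _ => rfl

/-- `t` on codes. [cite: AroraBarak2009, §1.3 (polynomial-time computation on codes)] -/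
theorem tNFP : CodeFP cnfE natE tN := ((natLength natE).comp dvarsFP).congr fun _ => rfl

/-- The renaming `rk` on codes. [cite: AroraBarak2009, §1.3 (polynomial-time computation on codes)] -/
theorem rkFP : CodeFP (pairE cnfE natE) natE (fun q => rk q.1 q.2) := by
  have idxOfFP : CodeFP (pairE natE (rawE natE)) natE (fun q => q.2.idxOf q.1) :=
    (findIdxFP (σ := ℕ) (α := ℕ) (p := fun q => q.2 == q.1)
      ((beq natE_injective).comp ((snd _ _).pair (fst _ _)))).congr fun _ => rfl
  exact (idxOfFP.comp ((snd _ _).pair (dvarsFP.comp (fst _ _)))).congr fun _ => rfl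

/-- The unary budget `1^{(7(L+s+1))⁴}`, `L` the number of literal occurrences. [cite: AroraBarak2009, §1.3 (polynomial-time computation on codes)] -/
theorem ubudgetFP : CodeFP cnfE (rawE unitE)
    (fun φ => List.replicate ((7 * ((vlist φ).length + φ.length + 1)) ^ 4) ()) := by
  have hs : CodeFP cnfE unE (fun φ : CNF ℕ => φ.length) :=
    ((ulength (listE litE)).comp (rawOfList (listE litE))).congr fun _ => rfl
  have hL : CodeFP cnfE unE (fun φ => (vlist φ).length) := ((ulength natE).comp vlistFP).congr fun _ => rfl
  have hY : CodeFP cnfE unE (fun φ => (vlist φ).length + φ.length + 1) :=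
    (unSucc.comp (unAdd.comp (hL.pair hs))).congr fun _ => rfl
  have h7 : CodeFP cnfE unE (fun φ => 7 * ((vlist φ).length + φ.length + 1)) :=
    (unAdd.comp (hY.pair (unAdd.comp (hY.pair (unAdd.comp (hY.pair (unAdd.comp (hY.pair
      (unAdd.comp (hY.pair (unAdd.comp (hY.pair hY)))))))))))).congr fun φ => by simp only; ring
  exact ((unitsPow 4).comp h7).congr fun _ => rfl

/-- `t ≤ L`. [cite: AroraBarak2009, §1.3 (polynomial-time computation on codes)] -/
theorem tN_le_vlist (φ : CNF ℕ) : tN φ ≤ (vlist φ).length := by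
  unfold tN dvars firstPos
  rw [List.length_map]
  exact (List.length_filter_le _ _).trans (by rw [List.length_range])

/-- The number of entries is within the budget. [cite: AroraBarak2009, §1.3 (polynomial-time computation on codes)] -/
theorem numEntriesT_le (φ : CNF ℕ) :
    (mOf φ + 1) * (nOfT φ * nOfT φ) ≤ (7 * ((vlist φ).length + φ.length + 1)) ^ 4 := by
  set Y := (vlist φ).length + φ.length + 1 with hY
  have h1 := tN_le_vlist φ
  have h2 := nA_le φ
  have hA : mOf φ + 1 ≤ 18 * (Y * Y) := by unfold mOf; nlinarith
  have hB : nOfT φ * nOfT φ ≤ 81 * (Y * Y) := by unfold nOfT; nlinarith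
  calc (mOf φ + 1) * (nOfT φ * nOfT φ) ≤ (18 * (Y * Y)) * (81 * (Y * Y)) := Nat.mul_le_mul hA hB
    _ ≤ (7 * Y) ^ 4 := by ring_nf; nlinarith

/-- `3s` is within the budget. [cite: AroraBarak2009, §1.3 (polynomial-time computation on codes)] -/
theorem three_len_le (φ : CNF ℕ) : 3 * φ.length ≤ (7 * ((vlist φ).length + φ.length + 1)) ^ 4 := by
  set Y := (vlist φ).length + φ.length + 1 with hY
  have h1 : 3 * φ.length ≤ 7 * Y := by omega
  have h2 : 1 ≤ 7 * Y := by omega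
  calc 3 * φ.length ≤ 7 * Y := h1
    _ = (7 * Y) ^ 1 := (pow_one _).symm
    _ ≤ (7 * Y) ^ 4 := Nat.pow_le_pow_right h2 (by norm_num)

/-- `range (3s)` on codes. [cite: AroraBarak2009, §1.3 (polynomial-time computation on codes)] -/
theorem range3FP : CodeFP cnfE (rawE natE) (fun φ => List.range (3 * φ.length)) :=
  ((brange unitE).comp (ubudgetFP.pair (natMul.comp ((const _ 3).pair lengthFP)))).congr fun φ => by
    simp only [List.length_replicate, min_eq_left (three_len_le φ)]

/-- `auxPairs` on codes. [cite: AroraBarak2009, §1.3 (polynomial-time computation on codes)] -/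
theorem auxPairsFP : CodeFP cnfE (rawE (pairE natE natE)) auxPairs := by
  have hprod : CodeFP cnfE (rawE (pairE natE natE))
      (fun φ => (List.range (3 * φ.length)) ×ˢ (List.range (3 * φ.length))) :=
    ((rawProduct natE natE).comp (range3FP.pair range3FP)).congr fun _ => rfl
  have hφ : CodeFP (pairE cnfE (pairE natE natE)) cnfE (fun t => t.1) := fst _ _
  have hu : CodeFP (pairE cnfE (pairE natE natE)) natE (fun t => t.2.1) := (snd _ _).fst'
  have hu' : CodeFP (pairE cnfE (pairE natE natE)) natE (fun t => t.2.2) := (snd _ _).snd'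
  have hvu : CodeFP (pairE cnfE (pairE natE natE)) natE (fun t => varAt t.1 (t.2.1 / 3) (t.2.1 % 3)) :=
    (varAtFP.comp (hφ.pair ((natDiv.comp (hu.pair (const _ 3))).pair (natMod.comp (hu.pair (const _ 3)))))).congr
      fun _ => rfl
  have hvu' : CodeFP (pairE cnfE (pairE natE natE)) natE (fun t => varAt t.1 (t.2.2 / 3) (t.2.2 % 3)) :=
    (varAtFP.comp (hφ.pair ((natDiv.comp (hu'.pair (const _ 3))).pair (natMod.comp (hu'.pair (const _ 3)))))).congr
      fun _ => rfl
  have hp : CodeFP (pairE cnfE (pairE natE natE)) bitE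
      (fun t => decide (t.2.1 ≠ t.2.2 ∧ varAt t.1 (t.2.1 / 3) (t.2.1 % 3) = varAt t.1 (t.2.2 / 3) (t.2.2 % 3))) :=
    ((not (natEq.comp (hu.pair hu'))).and (natEq.comp (hvu.pair hvu'))).congr fun t => by
      simp only [Bool.decide_and, decide_not, ne_eq]
  exact ((filter hp).comp ((CodeFP.id cnfE).pair hprod)).congr fun φ => rfl

/-- **The entry table on codes.** [cite: AroraBarak2009, §1.3 (polynomial-time computation on codes)] -/
theorem entryTFP : CodeFP ctxE intE (fun t => entryT t.1 t.2.1 t.2.2.1 t.2.2.2) := by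
  have hφ : CodeFP ctxE cnfE (fun t => t.1) := fst _ _
  have hh : CodeFP ctxE natE (fun t => t.2.1) := (snd _ _).fst'
  have hI : CodeFP ctxE natE (fun t => t.2.2.1) := (snd _ _).snd'.fst'
  have hJ : CodeFP ctxE natE (fun t => t.2.2.2) := (snd _ _).snd'.snd'
  have hI9 : CodeFP ctxE natE (fun t => t.2.2.1 / 9) := (natDiv.comp (hI.pair (const _ 9))).congr fun _ => rfl
  have hJ9 : CodeFP ctxE natE (fun t => t.2.2.2 / 9) := (natDiv.comp (hJ.pair (const _ 9))).congr fun _ => rfl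
  have hIr : CodeFP ctxE natE (fun t => t.2.2.1 % 9) := (natMod.comp (hI.pair (const _ 9))).congr fun _ => rfl
  have hJr : CodeFP ctxE natE (fun t => t.2.2.2 % 9) := (natMod.comp (hJ.pair (const _ 9))).congr fun _ => rfl
  have hIr2 : CodeFP ctxE natE (fun t => t.2.2.1 % 9 % 2) := (natMod.comp (hIr.pair (const _ 2))).congr fun _ => rfl
  have hJr2 : CodeFP ctxE natE (fun t => t.2.2.2 % 9 % 2) := (natMod.comp (hJr.pair (const _ 2))).congr fun _ => rfl
  have hIh : CodeFP ctxE natE (fun t => t.2.2.1 % 9 / 2) := (natDiv.comp (hIr.pair (const _ 2))).congr fun _ => rfl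
  have hJh : CodeFP ctxE natE (fun t => t.2.2.2 % 9 / 2) := (natDiv.comp (hJr.pair (const _ 2))).congr fun _ => rfl
  -- the constant slice
  have c1 : CodeFP ctxE bitE (fun t => decide (t.2.2.1 / 9 = t.2.2.2 / 9)) := natEq.comp (hI9.pair hJ9)
  have c2 : CodeFP ctxE bitE (fun t => decide (t.2.2.2 % 9 % 2 = 0 ∧ t.2.2.2 % 9 ≤ 4 ∧
      (t.2.2.1 % 9 = t.2.2.2 % 9 ∨ t.2.2.1 % 9 = t.2.2.2 % 9 + 1))) :=
    ((natEq.comp (hJr2.pair (const _ 0))).and ((natLe.comp (hJr.pair (const _ 4))).and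
      ((natEq.comp (hIr.pair hJr)).or (natEq.comp (hIr.pair (natAdd.comp (hJr.pair (const _ 1)))))))).congr
      fun t => by simp only [Bool.decide_and, Bool.decide_or]
  have c3 : CodeFP ctxE bitE (fun t => decide ((t.2.2.1 % 9 = 6 ∧ t.2.2.2 % 9 = 7) ∨ (t.2.2.1 % 9 = 7 ∧ t.2.2.2 % 9 = 8))) :=
    (((natEq.comp (hIr.pair (const _ 6))).and (natEq.comp (hJr.pair (const _ 7)))).or
      ((natEq.comp (hIr.pair (const _ 7))).and (natEq.comp (hJr.pair (const _ 8))))).congr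
      fun t => by simp only [Bool.decide_and, Bool.decide_or]
  have hpolA : CodeFP ctxE bitE (fun t => (litAt t.1 (t.2.2.1 / 9) (t.2.2.1 % 9 - 6)).2) :=
    (litAtFP.comp (hφ.pair (hI9.pair (natSub.comp (hIr.pair (const _ 6)))))).snd'.congr fun _ => rfl
  have c4 : CodeFP ctxE bitE (fun t => decide (t.2.2.1 % 9 = t.2.2.2 % 9 ∧ 6 ≤ t.2.2.1 % 9 ∧
      (litAt t.1 (t.2.2.1 / 9) (t.2.2.1 % 9 - 6)).2 = true)) :=
    ((natEq.comp (hIr.pair hJr)).and ((natLe.comp ((const _ 6).pair hIr)).and hpolA)).congr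
      fun t => by simp only [Bool.decide_and, Bool.decide_eq_true]
  have ha0 : CodeFP ctxE intE (fun t => a0T t.1 t.2.2.1 t.2.2.2) := by
    refine (c1.ite (c2.ite (const _ (1 : ℤ)) (c3.ite (const _ (1 : ℤ)) (c4.ite (const _ (1 : ℤ)) (const _ (0 : ℤ)))))
      (const _ (0 : ℤ))).congr fun t => ?_
    unfold a0T
    simp only [decide_eq_true_eq]
  -- the slices: `k = h - 1`
  have hk : CodeFP ctxE natE (fun t => t.2.1 - 1) := (natSub.comp (hh.pair (const _ 1))).congr fun _ => rfl
  have htN : CodeFP ctxE natE (fun t => tN t.1) := tNFP.comp hφ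
  have hs9 : CodeFP ctxE natE (fun t => t.1.length * 9) := (natMul.comp ((lengthFP.comp hφ).pair (const _ 9))).congr
    fun _ => rfl
  -- the variable slice `xT`
  have hrkI : CodeFP ctxE natE (fun t => rk t.1 (varAt t.1 (t.2.2.1 / 9) (t.2.2.1 % 9 / 2))) :=
    (rkFP.comp (hφ.pair (varAtFP.comp (hφ.pair (hI9.pair hIh))))).congr fun _ => rfl
  have hrkJ : CodeFP ctxE natE (fun t => rk t.1 (varAt t.1 (t.2.2.2 / 9) (t.2.2.2 % 9 / 2))) :=
    (rkFP.comp (hφ.pair (varAtFP.comp (hφ.pair (hJ9.pair hJh))))).congr fun _ => rfl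
  have cx : CodeFP ctxE bitE (fun t => decide ((t.2.2.1 % 9 % 2 = 0 ∧ t.2.2.1 % 9 ≤ 4 ∧
      rk t.1 (varAt t.1 (t.2.2.1 / 9) (t.2.2.1 % 9 / 2)) = t.2.1 - 1) ∧ (t.2.2.2 % 9 % 2 = 1 ∧ t.2.2.2 % 9 ≤ 5 ∧
      rk t.1 (varAt t.1 (t.2.2.2 / 9) (t.2.2.2 % 9 / 2)) = t.2.1 - 1))) :=
    (((natEq.comp (hIr2.pair (const _ 0))).and ((natLe.comp (hIr.pair (const _ 4))).and (natEq.comp (hrkI.pair hk)))).and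
      ((natEq.comp (hJr2.pair (const _ 1))).and ((natLe.comp (hJr.pair (const _ 5))).and (natEq.comp (hrkJ.pair hk))))).congr
      fun t => by simp only [Bool.decide_and]
  have hx : CodeFP ctxE intE (fun t => xT t.1 (t.2.1 - 1) t.2.2.1 t.2.2.2) := by
    refine (cx.ite (const _ (1 : ℤ)) (const _ (0 : ℤ))).congr fun t => ?_
    unfold xT
    simp only [decide_eq_true_eq]
  -- the local slices: `k' = k - t`, `j = k'/9`, `a = k' % 9 / 3`, `wh = k' % 9 % 3`
  have hk' : CodeFP ctxE natE (fun t => t.2.1 - 1 - tN t.1) := (natSub.comp (hk.pair htN)).congr fun _ => rfl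
  have hj' : CodeFP ctxE natE (fun t => (t.2.1 - 1 - tN t.1) / 9) := (natDiv.comp (hk'.pair (const _ 9))).congr fun _ => rfl
  have ha' : CodeFP ctxE natE (fun t => (t.2.1 - 1 - tN t.1) % 9 / 3) :=
    (natDiv.comp ((natMod.comp (hk'.pair (const _ 9))).pair (const _ 3))).congr fun _ => rfl
  have hw' : CodeFP ctxE natE (fun t => (t.2.1 - 1 - tN t.1) % 9 % 3) :=
    (natMod.comp ((natMod.comp (hk'.pair (const _ 9))).pair (const _ 3))).congr fun _ => rfl
  have h2a1 : CodeFP ctxE natE (fun t => 2 * ((t.2.1 - 1 - tN t.1) % 9 / 3) + 1) :=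
    (natAdd.comp ((natMul.comp ((const _ 2).pair ha')).pair (const _ 1))).congr fun _ => rfl
  have h6a : CodeFP ctxE natE (fun t => 6 + (t.2.1 - 1 - tN t.1) % 9 / 3) := (natAdd.comp ((const _ 6).pair ha')).congr
    fun _ => rfl
  have hpolL : CodeFP ctxE bitE (fun t => (litAt t.1 ((t.2.1 - 1 - tN t.1) / 9) ((t.2.1 - 1 - tN t.1) % 9 / 3)).2) :=
    (litAtFP.comp (hφ.pair (hj'.pair ha'))).snd'.congr fun _ => rfl
  have l0 : CodeFP ctxE bitE (fun t => decide (t.2.2.1 / 9 = (t.2.1 - 1 - tN t.1) / 9 ∧ t.2.2.2 / 9 = (t.2.1 - 1 - tN t.1) / 9)) :=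
    ((natEq.comp (hI9.pair hj')).and (natEq.comp (hJ9.pair hj'))).congr fun t => by simp only [Bool.decide_and]
  have lw0 : CodeFP ctxE bitE (fun t => decide ((t.2.1 - 1 - tN t.1) % 9 % 3 = 0)) := natEq.comp (hw'.pair (const _ 0))
  have lw1 : CodeFP ctxE bitE (fun t => decide ((t.2.1 - 1 - tN t.1) % 9 % 3 = 1)) := natEq.comp (hw'.pair (const _ 1))
  have lI : CodeFP ctxE bitE (fun t => decide (t.2.2.1 % 9 = 2 * ((t.2.1 - 1 - tN t.1) % 9 / 3) + 1 ∨
      t.2.2.1 % 9 = 6 + (t.2.1 - 1 - tN t.1) % 9 / 3)) :=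
    ((natEq.comp (hIr.pair h2a1)).or (natEq.comp (hIr.pair h6a))).congr fun t => by simp only [Bool.decide_or]
  have lJc : CodeFP ctxE bitE (fun t => decide (t.2.2.2 % 9 = 2 * ((t.2.1 - 1 - tN t.1) % 9 / 3) + 1)) :=
    natEq.comp (hJr.pair h2a1)
  have lJr : CodeFP ctxE bitE (fun t => decide (t.2.2.2 % 9 = 6 + (t.2.1 - 1 - tN t.1) % 9 / 3)) :=
    natEq.comp (hJr.pair h6a)
  have l1 : CodeFP ctxE bitE (fun t => decide (t.2.2.1 % 9 = 2 * ((t.2.1 - 1 - tN t.1) % 9 / 3) + 1 ∧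
      t.2.2.2 % 9 = 6 + (t.2.1 - 1 - tN t.1) % 9 / 3)) :=
    ((natEq.comp (hIr.pair h2a1)).and (natEq.comp (hJr.pair h6a))).congr fun t => by simp only [Bool.decide_and]
  have l2 : CodeFP ctxE bitE (fun t => decide (t.2.2.1 % 9 = 6 + (t.2.1 - 1 - tN t.1) % 9 / 3 ∧
      t.2.2.2 % 9 = 2 * ((t.2.1 - 1 - tN t.1) % 9 / 3) + 1)) :=
    ((natEq.comp (hIr.pair h6a)).and (natEq.comp (hJr.pair h2a1))).congr fun t => by simp only [Bool.decide_and]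
  have hloc : CodeFP ctxE intE (fun t => locT t.1 ((t.2.1 - 1 - tN t.1) / 9) ((t.2.1 - 1 - tN t.1) % 9 / 3)
      ((t.2.1 - 1 - tN t.1) % 9 % 3) t.2.2.1 t.2.2.2) := by
    refine (l0.ite
      (lw0.ite
        (lI.ite (lJc.ite (const _ (1 : ℤ)) (lJr.ite (hpolL.ite (const _ (-1 : ℤ)) (const _ (1 : ℤ))) (const _ (0 : ℤ))))
          (const _ (0 : ℤ)))
        (lw1.ite (l1.ite (const _ (-1 : ℤ)) (const _ (0 : ℤ))) (l2.ite (const _ (-1 : ℤ)) (const _ (0 : ℤ)))))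
      (const _ (0 : ℤ))).congr fun t => ?_
    unfold locT
    simp only [decide_eq_true_eq]
  -- the auxiliary slices
  have hidx : CodeFP ctxE natE (fun t => t.2.1 - 1 - tN t.1 - t.1.length * 9) := (natSub.comp (hk'.pair hs9)).congr
    fun _ => rfl
  have hpair : CodeFP ctxE (pairE natE natE) (fun t => (auxPairs t.1).getD (t.2.1 - 1 - tN t.1 - t.1.length * 9) (0, 0)) :=
    ((rawGetOr (pairE natE natE)).comp ((auxPairsFP.comp hφ).pair (hidx.pair (const _ ((0 : ℕ), (0 : ℕ)))))).congr
      fun _ => rfl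
  have hu : CodeFP ctxE natE (fun t => ((auxPairs t.1).getD (t.2.1 - 1 - tN t.1 - t.1.length * 9) (0, 0)).1) := hpair.fst'
  have hu' : CodeFP ctxE natE (fun t => ((auxPairs t.1).getD (t.2.1 - 1 - tN t.1 - t.1.length * 9) (0, 0)).2) := hpair.snd'
  have hrow : CodeFP ctxE natE (fun t => 9 * (((auxPairs t.1).getD (t.2.1 - 1 - tN t.1 - t.1.length * 9) (0, 0)).1 / 3) +
      2 * (((auxPairs t.1).getD (t.2.1 - 1 - tN t.1 - t.1.length * 9) (0, 0)).1 % 3)) :=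
    (natAdd.comp ((natMul.comp ((const _ 9).pair (natDiv.comp (hu.pair (const _ 3))))).pair
      (natMul.comp ((const _ 2).pair (natMod.comp (hu.pair (const _ 3))))))).congr fun _ => rfl
  have hcol : CodeFP ctxE natE (fun t => 9 * (((auxPairs t.1).getD (t.2.1 - 1 - tN t.1 - t.1.length * 9) (0, 0)).2 / 3) +
      (2 * (((auxPairs t.1).getD (t.2.1 - 1 - tN t.1 - t.1.length * 9) (0, 0)).2 % 3) + 1)) :=
    (natAdd.comp ((natMul.comp ((const _ 9).pair (natDiv.comp (hu'.pair (const _ 3))))).pair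
      (natAdd.comp ((natMul.comp ((const _ 2).pair (natMod.comp (hu'.pair (const _ 3))))).pair (const _ 1))))).congr
      fun _ => rfl
  have caux : CodeFP ctxE bitE (fun t => decide
      (t.2.2.1 = 9 * (((auxPairs t.1).getD (t.2.1 - 1 - tN t.1 - t.1.length * 9) (0, 0)).1 / 3) +
          2 * (((auxPairs t.1).getD (t.2.1 - 1 - tN t.1 - t.1.length * 9) (0, 0)).1 % 3) ∧
        t.2.2.2 = 9 * (((auxPairs t.1).getD (t.2.1 - 1 - tN t.1 - t.1.length * 9) (0, 0)).2 / 3) +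
          (2 * (((auxPairs t.1).getD (t.2.1 - 1 - tN t.1 - t.1.length * 9) (0, 0)).2 % 3) + 1))) :=
    ((natEq.comp (hI.pair hrow)).and (natEq.comp (hJ.pair hcol))).congr fun t => by simp only [Bool.decide_and]
  have haux : CodeFP ctxE intE (fun t =>
      auxT ((auxPairs t.1).getD (t.2.1 - 1 - tN t.1 - t.1.length * 9) (0, 0)).1
        ((auxPairs t.1).getD (t.2.1 - 1 - tN t.1 - t.1.length * 9) (0, 0)).2 t.2.2.1 t.2.2.2) := by
    refine (caux.ite (const _ (1 : ℤ)) (const _ (0 : ℤ))).congr fun t => ?_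
    unfold auxT
    simp only [decide_eq_true_eq]
  -- dispatch on `k`
  have d1 : CodeFP ctxE bitE (fun t => decide (t.2.1 - 1 < tN t.1)) := natLt.comp (hk.pair htN)
  have d2 : CodeFP ctxE bitE (fun t => decide (t.2.1 - 1 < tN t.1 + t.1.length * 9)) :=
    natLt.comp (hk.pair (natAdd.comp (htN.pair hs9)))
  have hsl : CodeFP ctxE intE (fun t => sliceT t.1 (t.2.1 - 1) t.2.2.1 t.2.2.2) := by
    refine (d1.ite hx (d2.ite hloc haux)).congr fun t => ?_
    unfold sliceT
    simp only [decide_eq_true_eq]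
  refine ((natEq.comp (hh.pair (const _ 0))).ite ha0 hsl).congr fun t => ?_
  unfold entryT
  simp only [decide_eq_true_eq]

/-- **The entry list on codes.** [cite: AroraBarak2009, §1.3 (polynomial-time computation on codes)] -/
theorem entriesTFP : CodeFP cnfE (rawE intE) entriesT := by
  have hn : CodeFP cnfE natE nOfT := (natMul.comp (lengthFP.pair (const _ 9))).congr fun _ => rfl
  have hm1 : CodeFP cnfE natE (fun φ => mOf φ + 1) :=
    (natAdd.comp ((natAdd.comp (tNFP.pair (natAdd.comp ((natMul.comp (lengthFP.pair (const _ 9))).pair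
      ((natLength (pairE natE natE)).comp auxPairsFP))))).pair (const _ 1))).congr fun _ => rfl
  have hM : CodeFP cnfE natE (fun φ => (mOf φ + 1) * (nOfT φ * nOfT φ)) :=
    (natMul.comp (hm1.pair (natMul.comp (hn.pair hn)))).congr fun _ => rfl
  have hrange : CodeFP cnfE (rawE natE) (fun φ => List.range ((mOf φ + 1) * (nOfT φ * nOfT φ))) :=
    ((brange unitE).comp (ubudgetFP.pair hM)).congr fun φ => by
      simp only [List.length_replicate, min_eq_left (numEntriesT_le φ)]
  have hN : CodeFP (pairE cnfE natE) natE (fun q => q.2) := snd _ _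
  have hn' : CodeFP (pairE cnfE natE) natE (fun q => nOfT q.1) := hn.comp (fst _ _)
  have hitem : CodeFP (pairE cnfE natE) intE
      (fun q => entryT q.1 (q.2 / (nOfT q.1 * nOfT q.1)) (q.2 / nOfT q.1 % nOfT q.1) (q.2 % nOfT q.1)) :=
    (entryTFP.comp ((fst _ _).pair ((natDiv.comp (hN.pair (natMul.comp (hn'.pair hn')))).pair
      ((natMod.comp ((natDiv.comp (hN.pair hn')).pair hn')).pair (natMod.comp (hN.pair hn')))))).congr fun _ => rfl
  exact ((map hitem).comp ((CodeFP.id cnfE).pair hrange)).congr fun _ => rfl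

/-- **The instance `instT` on codes.** [cite: AroraBarak2009, §1.3 (polynomial-time computation on codes)] -/
theorem instTFP : CodeFP cnfE instE instT := by
  have hn : CodeFP cnfE natE nOfT := (natMul.comp (lengthFP.pair (const _ 9))).congr fun _ => rfl
  have hm : CodeFP cnfE natE mOf :=
    (natAdd.comp (tNFP.pair (natAdd.comp ((natMul.comp (lengthFP.pair (const _ 9))).pair
      ((natLength (pairE natE natE)).comp auxPairsFP))))).congr fun _ => rfl
  have he : CodeFP cnfE (listE smE) entriesT :=
    ((listOfRaw smE).comp ((map₀ smOfInt).comp entriesTFP)).congr fun _ => by simp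
  have hr : CodeFP cnfE natE (fun φ => 5 * φ.length + mOf φ) :=
    (natAdd.comp ((natMul.comp ((const _ 5).pair lengthFP)).pair hm)).congr fun _ => rfl
  exact (hn.pair (hm.pair (he.pair hr))).congr fun _ => rfl

/-- **The guard** "E3-CNF with a clause" on codes. [cite: AroraBarak2009, §1.3 (polynomial-time computation on codes)] -/
theorem guardTFP : CodeFP cnfE bitE (fun ψ : CNF ℕ => decide (ψ.IsExactWidth 3 ∧ 0 < ψ.length)) := by
  have hitem : CodeFP (pairE cnfE (rawE litE)) bitE
      (fun q => decide (q.2.length = 3) && decide ((q.2.map Prod.fst).Nodup)) :=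
    ((natEq.comp (((natLength litE).comp (snd _ _)).pair (const _ 3))).and
      ((nodup natE_injective).comp ((map₀ (fst natE bitE)).comp (snd _ _)))).congr fun _ => rfl
  have hall : CodeFP cnfE bitE (fun ψ : CNF ℕ => ψ.all fun c => decide (c.length = 3) && decide ((c.map Prod.fst).Nodup)) :=
    ((all (σ := CNF ℕ) (α := List (ℕ × Bool))
      (p := fun q => decide (q.2.length = 3) && decide ((q.2.map Prod.fst).Nodup)) hitem).comp
      ((CodeFP.id _).pair clausesFP)).congr fun _ => rfl
  have hpos : CodeFP cnfE bitE (fun ψ : CNF ℕ => decide (0 < ψ.length)) := natLt.comp ((const _ 0).pair lengthFP)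
  refine (hall.and hpos).congr fun ψ => ?_
  rw [Bool.eq_iff_iff, Bool.and_eq_true, List.all_eq_true, decide_eq_true_iff, decide_eq_true_iff]
  unfold IsExactWidth
  simp only [Bool.and_eq_true, decide_eq_true_iff]

/-- **The instance map `redT` is computed on codes by a polynomial-time string function.** [cite: AroraBarak2009, §1.3 (polynomial-time computation on codes)] -/
theorem redTFP : CodeFP cnfE instE redT := by
  refine (guardTFP.ite instTFP (const _ yesInst)).congr fun ψ => ?_
  unfold redT
  simp only [decide_eq_true_eq]

/-- `redT` on the official codes. [cite: AroraBarak2009, §1.3 (polynomial-time computation on codes)] -/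
theorem redT_FP : ∃ f ∈ FP, ∀ ψ : CNF ℕ, f (encodingCNF.encode ψ) = tensorInstEncoding.encode (redT ψ) := by
  obtain ⟨f, hf, hspec⟩ := redTFP
  refine ⟨f, hf, fun ψ => ?_⟩
  rw [cnfE_eq, instE_eq]
  exact hspec ψ

end Machine

end BIJL18TRGap

section Discharge

variable (K : Type u) [Field K]

/-- **Theorem 23** (Bläser–Ikenmeyer–Jindal–Lysikov 2018), discharged for EVERY field `K`: "Let `k` be
`ℝ` or `ℂ`. There is a `γ > 0` such that it is NP-hard to approximate the tensor rank within
`1 + γ` ... this problem remains NP-hard if we restrict inputs to tensors with `n` slices of rank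
`1` and one additional slice." — here `∃ γ > 0, (gapTensorRankProblem K γ).IsNPHard`, by the printed
route: bounded-occurrence gap-E3SAT (`gapE3SATOcc_isNPHard_some`, Dinur's PCP with the structural
occurrence bound of `GapE3SATBoundedOccurrence.lean`) `≤ₚ` the tensor `T_φ` of §5 (renamed onto
`Fin t`, Thm. 18 `R = CR + m` via `TPhiRank.tensorRank_tphi_reindex`, Lemma 22 in its
bounded-occurrence form `BIJL2018_lemma22_gap`), computed on codes by `BIJL18TRGap.redTFP`.
[cite: BlaserIkenmeyerJindalLysikov2018, Thm. 23 (§5, ECCC p. 14)] -/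
theorem BIJL2018_thm23_holds : BIJL2018_thm23 K :=
  BIJL18TRGap.thm23_of_FP K BIJL18TRGap.redT_FP

end Discharge

end Literature.Barriers.ValiantsHypothesis

end
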